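import Summits.FinalStateConjecture.FinalStateConjecture.Theses.StarvedNecks
import Summits.FinalStateConjecture.FinalStateConjecture.Theorems.SeamedChartsExhaust.Negative.ReversedFlatChart
import Literature.Geometry.Lorentzian.CausalityPushUp
import Literature.Geometry.Lorentzian.CausalFutureProofs
import Literature.Geometry.Lorentzian.MinkowskiGlobalHyperbolicity
import Literature.Geometry.Lorentzian.KerrConvergenceProofs
import Literature.Geometry.Lorentzian.HypersurfaceRestriction
import Literature.Geometry.Lorentzian.BoundedGeometry

/-!
# Line `abstract-exterior` — skeleton for crux `StarvedNecks.SeamedChartsExhaust`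
(item stmt-FinalStateConjecture-13551, route `route-FinalStateConjecture-StarvedNecks`, rank 4;
crux-plan seat `planner-cruxplan-stmt-FinalStateConjecture-13551-abstract-exterior-0`, 2026-08-16)

**Idea (card `Ideas/abstract-exterior.md`).** The covering clause (ii) of `HasExhaustiveCharts` is a
property of the CHART PACKAGE `(d, R, R₀)` and of two ORDER-THEORETIC properties of the region `O`:
(E1) cofinality `O ⊆ I⁻(d.charted)` and (E2) diamond-convexity `J⁺(p) ∩ J⁻(q) ⊆ O` (`p, q ∈ O`).
The skeleton proves the crux THROUGH the abstract statement `AbstractExhaust` (C⁺: every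
time-oriented spacetime, every such `O`; no datum, no MGHD, no field equation), whose transfer to the
crux is proved (`crux_of_abstract`), and PROVES every chart-bookkeeping step of C⁺ except two:

* `stub_firstContact : FirstContact`      (hardest, L) — the flat `e₀`-ray from a flat-late point up to
  FIRST CONTACT with the closed certified tubes `⋃ₖ {rₖ ≤ Rₖ(tₖ)}` (or up to the flat slab): the one
  place where HonestCore (d) — the flat chart's time orientation — is consumed, and the only
  real-analysis step of the crux (infimum on `Icc`, continuity, openness collars);
* `stub_frontier : FrontierBelowSlab`      (M) — the frontier of the (open) certified late region
  inside `O` lies below the certified slab: closure clauses SEAMED (11), HonestCore (c), one wall ride.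

`SeamedChartsExhaust_of (h_firstContact : FirstContact) (h_frontier : FrontierBelowSlab) :
  Theses.StarvedNecks.SeamedChartsExhaust` is PROVED (no `sorry`) as
`crux_of_abstract ∘ abstract_of_stubs`, where `abstract_of_stubs : FirstContact → FrontierBelowSlab →
AbstractExhaust` chains the PROVED pieces: `firstEntryCovering` (metric-free first-entry lemma),
`isOpen_certifiedLate` (lateral walls are flat-late), `chartedReach_of_boarding : FlatBoarding →
ChartedReach` (routing of charted points: `holeAnchoring` = HonestCore (b) at `ϱ = Rᵢ(τ₁)`, the disc,
collar ⇒ flat by SEAMED (9), (8), (12), (6), far leaf ⇒ flat by (10)), `flatBoarding_of_firstContact :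
FirstContact → FlatBoarding` (via `boardAtContact`: SEAMED (7), (1), HonestCore (a) put the contact
point in `domₖ`, ONE ATLAS (6), clock lag (9)), and the RIDE `tubeRide : TubeRide` (the co-moving
`Λⱼe₀`-segment on a certified tube is a causal curve ending on the hole disc — SEAMED (5), (1),
HonestCore (a); kinematics `poincareInv_add_smul`/`time_add_smul`/`radius_add_smul`; adapter
`line_mem_causalFuture`: coordinate lines through charts are causal curves, from `Disproof.lean` §4).

So after this file the crux is EQUIVALENT-IN-PRACTICE to `FirstContact ∧ FrontierBelowSlab`, both
stated for an arbitrary spacetime and arbitrary `(O, d, R, R₀)` (5 binders, no typeclass tower), and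
the abstract theorem C⁺ comes for free with the crux (reusable by any restated exhaustiveness crux over
a different `O`, e.g. after the `NecksCertify` repair, and by the capture cruxes of TangentConeAtIPlus /
RaychaudhuriBlowdown / TwoBoundarySqueeze, which need the same bookkeeping).

DISPROOF USED (kernel-checked here): `not_flatBoarding_without_orientation` — BOARDING with
HonestCore (d) deleted is FALSE, by the model of the LANDED negative lemma
`Theorems/SeamedChartsExhaust/Negative/ReversedFlatChart.lean` (time-reversed flat chart on Minkowski;
`WithoutFutureOrientation.lean`, p73931: `not_forall_hasExhaustiveCharts_without_futureOrientation`).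
Hence the line uses H = HonestCore (d) exactly at `stub_firstContact`; no stub is an instance of the
refuted dropped-(d) statement (both carry the full `Hc`). Decorative hypotheses (Disproof §2: vacuum,
maximality, admissibility, sub-extremality, SEAMED (3), (4)) are not used by any proof here either.

REGRESSION HARNESS (kernel-checked): §7 the `N = 0` case of C⁺ and of both stub statements in EVERY
spacetime (`firstContact_N0`, `flatBoarding_N0`, `chartedReach_N0`, `frontierBelowSlab_N0`,
`abstractExhaust_N0`); §8 `MinkowskiN0.regressionTest`: on `Minkowski.spacetime` with `O = {0 ≤ x⁰}`,
inclusion flat chart, `τ₀ = 0`, `N = 0`, the hypotheses (E1) ∧ (E2) ∧ `Hc` ∧ `Sm` HOLD (joint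
satisfiability of every stub's hypotheses), and so do `HasExhaustiveCharts d0` and the `d0`-instances
of both stubs — a unit test of the sign/strictness conventions of `certifiedLate`/`certifiedSlab`/
SEAMED (11) that re-runs unchanged against any repaired SEAMED-R.

`Hc`/`Sm` below are VERBATIM copies of the crux's let-bound predicates (`crux_iff : … := Iff.rfl`), so
every statement here is definitionally the corresponding statement of the sibling sketches
(Sketch3 `TubeRide`/`FlatBoarding`/`ChartedReach`/`FrontierBelowSlab`, Ideate1 `DrainCharted`/
`RimInclusion`, OneCurveDichotomy `ascent_K1`): the triage-3 merge certificates (`drain_iff_reach`,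
`rim_iff_frontier`, `tubeRide_of_escalator`) apply unchanged, and a proof of `stub_frontier` serves
every line. Proved material reused with attribution from the crux workfiles `SketchIdeator1.lean`
(Ideate1), `SketchIdeator3.lean` (Sketch3), `Disproof.lean`, `TRIAGE-r1-3.lean` (Triage3).
-/

noncomputable section

open Set Filter Topology Function TopologicalSpace
open scoped Manifold ContDiff ENNReal Topology
open Literature.Geometry.Lorentzian

namespace Summit.FinalStateConjecture.FinalStateConjecture.Cruxes.SeamedChartsExhaust.AbstractExterior

set_option linter.dupNamespace false
set_option linter.unusedVariables false

/-! ## §0 The crux's let-bound predicates, named (verbatim copies) -/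

/-- HonestCore `Hc(𝓢, O, k, d, R₀)`: (a) sub-extremal holes, `100 Mᵢ ≤ R₀`, orthochronous boosts;
(b) anchoring; (c) relative closedness in `O` of late tube portions; (d) future-oriented flat chart. -/
def Hc (𝓢 : Spacetime.{0} 4) (O : Set 𝓢.carrier) (k : ℕ) (d : FinalStateDecomposition 𝓢 O k)
    (R₀ : ℝ) : Prop :=
  let B := d.background; let t := fun i ↦ (B i).time; let r := fun i ↦ (B i).radius; let Ψ := d.chart;
  (∀ i, Kerr.IsSubextremal (d.mass i) (d.spin i) ∧ 100 * d.mass i ≤ R₀ ∧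
      0 < ((d.motion i).1 : E4 ≃L[ℝ] E4) (E4.basisVector 0) 0) ∧
  (∀ i (ϱ τ₂ : ℝ), R₀ ≤ ϱ → d.τ₀ < τ₂ →
      Ψ i '' {x | d.τ₀ < t i x.1 ∧ t i x.1 < τ₂ ∧ r i x.1 < ϱ} ⊆
        𝓢.metric.causalPast 𝓢.timeOrientation (Ψ i '' (B i).truncTimeSlab ϱ τ₂)) ∧
  (∀ i (τ' : ℝ) (ϱ : ℝ → ℝ), Continuous ϱ → d.τ₀ < τ' →
      let A := Ψ i '' {x | τ' ≤ t i x.1 ∧ r i x.1 ≤ ϱ (t i x.1)}; closure A ∩ O ⊆ A) ∧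
  (∀ y : d.flatDomain, d.τ₀ < y.1 0 →
      𝓢.timeOrientation.IsFutureDirected (mfderiv 𝓘(ℝ, E4) (𝓡 4) d.flatChart y (E4.basisVector 0)))

/-- SEAMED `Sm(𝓢, O, d, R, R₀)`, twelve conjuncts (1)–(12) as in `Disproof.lean` §1. -/
def Sm (𝓢 : Spacetime.{0} 4) (O : Set 𝓢.carrier) (d : FinalStateDecomposition 𝓢 O 2)
    (R : Fin d.N → ℝ → ℝ) (R₀ : ℝ) : Prop :=
  let B := d.background; let t := fun i ↦ (B i).time; let r := fun i ↦ (B i).radius;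
  let Λ := fun i ↦ ((d.motion i).1 : E4 ≃L[ℝ] E4); let Φ := d.flatChart; let Ψ := d.chart; let ρ := d.excision;
  (∀ i, Monotone (R i) ∧ Continuous (R i) ∧ ∀ s, R₀ + 4 ≤ R i s ∧ R₀ ≤ ρ i s) ∧
  (∀ i, Tendsto (fun τ ↦ 𝓢.truncDeviationCk (B i) (Ψ i) 2 (R i τ) τ) atTop (𝓝 0)) ∧
  supCkENorm (Subtype.val '' {y : d.flatDomain | d.τ₀ ≤ y.1 0}) 0
      (𝓢.deviationExtend (Minkowski.backgroundOn d.flatDomain) Φ) ≤ 10⁻¹ ∧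
  (∀ i, supCkENorm (Subtype.val '' {x : (B i).domain | (d.τ₀ ≤ t i x.1 ∨ d.τ₀ ≤ x.1 0) ∧ R₀ ≤ r i x.1 ∧
      r i x.1 ≤ R i (t i x.1)}) 0 (𝓢.deviationExtend (B i) (Ψ i)) ≤
        ENNReal.ofReal (1 / (10 * ‖(Λ i : E4 →L[ℝ] E4)‖ ^ 2))) ∧
  (∀ i (x : (B i).domain), (d.τ₀ ≤ t i x.1 ∨ d.τ₀ ≤ x.1 0) → R₀ ≤ r i x.1 → r i x.1 ≤ R i (t i x.1) →
      𝓢.timeOrientation.IsFutureDirected (mfderiv 𝓘(ℝ, E4) (𝓡 4) (Ψ i) x ((Λ i) (E4.basisVector 0)))) ∧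
  (∀ i (y : E4) (hy : y ∈ (B i).domain), d.τ₀ ≤ y 0 → (∀ j, ρ j (y 0) < r j y) →
      r i y ≤ R i (t i y) + 1 → ∃ hy' : y ∈ d.flatDomain, Ψ i ⟨y, hy⟩ = Φ ⟨y, hy'⟩) ∧
  (∀ y : d.flatDomain, d.τ₀ ≤ y.1 0 → ∀ j, ρ j (y.1 0) < r j y.1) ∧
  (∀ j (y : E4), d.τ₀ ≤ y 0 → r j y ≤ ρ j (y 0) → r j y + 2 ≤ R j (t j y)) ∧
  (∀ j (y : E4), d.τ₀ ≤ t j y → r j y ≤ R j (t j y) + 2 → t j y ≤ y 0) ∧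
  (∀ j, Ψ j '' {x | d.τ₀ < t j x.1 ∧ R j (t j x.1) + 1 < r j x.1} ⊆ d.radiationZone) ∧
  (∀ τ' : ℝ, d.τ₀ < τ' → closure (Φ '' {y | τ' ≤ y.1 0}) ⊆
      Φ '' {y | τ' ≤ y.1 0} ∪ ⋃ j, Ψ j '' {x | τ' ≤ x.1 0 ∧ r j x.1 = ρ j (x.1 0)}) ∧
  (∀ j j' (y : E4), j ≠ j' → (d.τ₀ ≤ y 0 ∨ d.τ₀ ≤ t j y) → r j y ≤ R j (t j y) + 1 →
      R j' (t j' y) + 1 < r j' y)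

/-- READ-BACK (`Iff.rfl`): the crux with the named copies `Hc`, `Sm` is definitionally the route
decl `Theses.StarvedNecks.SeamedChartsExhaust`. -/
theorem crux_iff :
    Summit.FinalStateConjecture.FinalStateConjecture.Theses.StarvedNecks.SeamedChartsExhaust ↔
    (∀ (X : Type) [TopologicalSpace X] [ChartedSpace E3 X] [IsManifold (𝓡 3) ∞ X]
      [ConnectedSpace X] (D : InitialDataSet (𝓡 3) X), D ∈ admissibleVacuumData X →
      ∀ 𝒟 : VacuumCauchyDevelopment D, 𝒟.IsMaximal →
      ∀ (O : Set 𝒟.carrier) (d : FinalStateDecomposition 𝒟.toSpacetime O 2)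
        (R : Fin d.N → ℝ → ℝ) (R₀ : ℝ), O = exteriorOf 𝒟.toCauchyDevelopment d.charted →
        Hc 𝒟.toSpacetime O 2 d R₀ → Sm 𝒟.toSpacetime O d R R₀ → HasExhaustiveCharts d) :=
  Iff.rfl

/-! ## §1 The abstract frame: C⁺ and the proved transfer C⁺ ⇒ crux -/

/-- Reducible alias of the route decl (the crux). Used ONLY as the result type of the transfer lemma
`crux_of_abstract`, so that exactly one theorem of this file — the composition `SeamedChartsExhaust_of` —
concludes the crux under its declared name (the skeleton audit keys on that). -/
abbrev Crux : Prop :=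
  Summit.FinalStateConjecture.FinalStateConjecture.Theses.StarvedNecks.SeamedChartsExhaust

/-- **C⁺ (`AbstractExhaust`)**: for EVERY time-oriented spacetime `𝓢`, every region `O` that is
(E1) cofinal under the charts, `O ⊆ I⁻(d.charted)`, and (E2) diamond-convex,
`J⁺(p) ∩ J⁻(q) ⊆ O` for `p, q ∈ O`, and every `C²` decomposition `d` of `O` with radii `R, R₀`:
`Hc ∧ Sm ⇒ HasExhaustiveCharts d`. No datum, no MGHD, no field equation. -/
def AbstractExhaust : Prop :=
  ∀ (𝓢 : Spacetime.{0} 4) (O : Set 𝓢.carrier) (d : FinalStateDecomposition 𝓢 O 2)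
    (R : Fin d.N → ℝ → ℝ) (R₀ : ℝ),
    O ⊆ 𝓢.metric.chronologicalPast 𝓢.timeOrientation d.charted →
    (∀ p ∈ O, ∀ q ∈ O, 𝓢.metric.causalFuture 𝓢.timeOrientation {p} ∩
        𝓢.metric.causalPast 𝓢.timeOrientation {q} ⊆ O) →
    Hc 𝓢 O 2 d R₀ → Sm 𝓢 O d R R₀ → HasExhaustiveCharts d

section Exterior

variable {X : Type} [TopologicalSpace X] [ChartedSpace E3 X] [IsManifold (𝓡 3) ∞ X]
  [ConnectedSpace X] {D : InitialDataSet (𝓡 3) X}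

/-- (E1) for the route's exterior: `exteriorOf 𝒟 U ⊆ I⁻(U)` (second intersectand). (Ideate1) -/
theorem exteriorOf_cofinal (𝒟 : CauchyDevelopment D) (U : Set 𝒟.carrier) :
    exteriorOf 𝒟 U ⊆ 𝒟.metric.chronologicalPast 𝒟.timeOrientation U :=
  inter_subset_right

/-- (E2) for the route's exterior: `J⁺(p) ∩ J⁻(q) ⊆ exteriorOf 𝒟 U` for `p, q` in it — transitivity
of `J⁺` (`causalFuture_causalFuture_eq`) and push-up `x ≤ q ≪ m ⇒ x ≪ m`
(`mem_chronologicalFuture_of_mem_causalFuture`), the d.o.c. pattern. (Ideate1) -/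
theorem exteriorOf_diamond (𝒟 : CauchyDevelopment D) (U : Set 𝒟.carrier)
    {p q : 𝒟.carrier} (hp : p ∈ exteriorOf 𝒟 U) (hq : q ∈ exteriorOf 𝒟 U) :
    𝒟.metric.causalFuture 𝒟.timeOrientation {p} ∩ 𝒟.metric.causalPast 𝒟.timeOrientation {q} ⊆
      exteriorOf 𝒟 U := by
  rintro x ⟨hxp, hxq⟩
  have hn : (2 : WithTop ℕ∞) ≤ ((⊤ : ℕ∞) : WithTop ℕ∞) := WithTop.coe_le_coe.mpr le_top
  have hn1 : (1 : WithTop ℕ∞) ≤ ((⊤ : ℕ∞) : WithTop ℕ∞) := WithTop.coe_le_coe.mpr le_top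
  refine ⟨?_, ?_⟩
  · have h1 : x ∈ 𝒟.metric.causalFuture 𝒟.timeOrientation
        (𝒟.metric.causalFuture 𝒟.timeOrientation (range 𝒟.embed)) :=
      LorentzianMetric.causalFuture_mono (singleton_subset_iff.mpr hp.1) hxp
    rwa [LorentzianMetric.causalFuture_causalFuture_eq hn] at h1
  · obtain ⟨m, hm, γ, a, b, hab, hγ, hγa, hγb⟩ := hq.2
    have hqm : q ∈ 𝒟.metric.chronologicalPast 𝒟.timeOrientation {m} :=
      ⟨m, rfl, γ, a, b, hab, hγ, hγa, hγb⟩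
    have h1 : q ∈ 𝒟.metric.causalFuture 𝒟.timeOrientation {x} :=
      LorentzianMetric.mem_causalPast_singleton_iff.mp hxq
    have h2 : m ∈ 𝒟.metric.chronologicalFuture 𝒟.timeOrientation {q} :=
      LorentzianMetric.mem_chronologicalFuture_of_mem_chronologicalPast hqm
    have h3 : m ∈ 𝒟.metric.chronologicalFuture 𝒟.timeOrientation {x} :=
      LorentzianMetric.mem_chronologicalFuture_of_mem_causalFuture hn1 h1 h2
    have h4 : x ∈ 𝒟.metric.chronologicalPast 𝒟.timeOrientation {m} :=
      LorentzianMetric.mem_chronologicalPast_of_mem_chronologicalFuture h3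
    exact LorentzianMetric.chronologicalFuture_mono (g := 𝒟.metric)
      (τ := 𝒟.timeOrientation.reverse) (singleton_subset_iff.mpr hm) h4

end Exterior

/-- **Transfer C⁺ ⇒ C** (PROVED): `AbstractExhaust` implies the crux verbatim, because the
self-determined exterior `exteriorOf 𝒟 d.charted = J⁺(ι X) ∩ I⁻(d.charted)` is cofinal (E1) and
diamond-convex (E2). The datum, MGHD, vacuum and maximality binders are inert. -/
theorem crux_of_abstract (h : AbstractExhaust) : Crux := by
  intro X _ _ _ _ D _ 𝒟 _ O d R R₀ hO hc hs
  refine h 𝒟.toSpacetime O d R R₀ ?_ ?_ hc hs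
  · intro p hp
    rw [hO] at hp
    exact exteriorOf_cofinal 𝒟.toCauchyDevelopment d.charted hp
  · intro p hp q hq x hx
    rw [hO] at hp hq ⊢
    exact exteriorOf_diamond 𝒟.toCauchyDevelopment d.charted hp hq hx

/-! ## §2 The chart-bookkeeping statements (verbatim the triage panel's RIDE/REACH/FRONTIER, plus the
isolated analytic core `FirstContact` of BOARDING) -/

/-- **RIDE.** A point of hole chart `j` on the certified tube `R₀ ≤ rⱼ ≤ Rⱼ(tⱼ)` (hole-late OR
flat-late) with hole time `tⱼ ≤ τ₁` lies in `J⁻(certifiedSlab d R τ₁)`: the co-moving segment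
`u ↦ Ψⱼ(x + u Λⱼe₀)`, `u ∈ [0, τ₁ − tⱼ]`, has constant rest-frame radius, hole clock `tⱼ + u`, lab clock
`x⁰ + u (Λⱼe₀)⁰` non-decreasing (HonestCore (a), orthochronous), so SEAMED (5) certifies its velocity all
along (`R` monotone, SEAMED (1)) and it ends on `truncTimeSlab (Rⱼ τ₁) τ₁ ⊆ certifiedSlab`.
Clauses: Hc(a)-orth, Sm1 (monotone), Sm5. Size S–M (adapter `line_mem_causalFuture` + kinematics
`poincareInv_add_smul`/`radius_add_smul` are proved below). (= Sketch3.TubeRide, OneCurve `escalator`.) -/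
def TubeRide : Prop :=
  ∀ (𝓢 : Spacetime.{0} 4) (O : Set 𝓢.carrier) (d : FinalStateDecomposition 𝓢 O 2)
    (R : Fin d.N → ℝ → ℝ) (R₀ : ℝ), Hc 𝓢 O 2 d R₀ → Sm 𝓢 O d R R₀ →
    ∀ τ₁ : ℝ, d.τ₀ < τ₁ → ∀ (j : Fin d.N) (x : (d.background j).domain),
      (d.τ₀ ≤ (d.background j).time x.1 ∨ d.τ₀ ≤ x.1 0) → R₀ ≤ (d.background j).radius x.1 →
      (d.background j).radius x.1 ≤ R j ((d.background j).time x.1) →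
      (d.background j).time x.1 ≤ τ₁ →
      d.chart j x ∈ 𝓢.metric.causalPast 𝓢.timeOrientation (certifiedSlab d R τ₁)

/-- **BOARDING.** A flat-late point `Φ(y)` with `τ₀ < y⁰ ≤ τ₁` lies in `J⁻(certifiedSlab d R τ₁)`:
the `e₀`-ray `σ ↦ Φ(y + σ e₀)` is future causal while in `U` (HonestCore (d) — THE load-bearing use of
the flat chart's time orientation, cf. `not_flatBoarding_without_orientation`); it stays in `U` up to
FIRST CONTACT with the closed set `⋃ₖ {rₖ ≤ Rₖ(tₖ)}` (before contact SEAMED (8)-contrapositive gives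
`ρₖ(x⁰) < rₖ`, then the structure field `setOf_lt_excision_subset_flatDomain`), so either it reaches
the flat slab `{x⁰ = τ₁} ⊆ certifiedSlab`, or at the contact point `u` (`rₖu = Rₖ(tₖu) ≥ R₀ + 4 > r₊`,
`u ∈ domₖ`) ONE ATLAS SEAMED (6) (tube exclusion from (7)) gives `Φ u = Ψₖ u`, SEAMED (9) gives
`tₖ u ≤ u⁰ ≤ τ₁`, and the RIDE finishes. Clauses: Hc(a) (`100M ≤ R₀` ⇒ `r₊ < R₀`), Hc(d), Sm1, Sm6,
Sm7, Sm8, Sm9, `TubeRide`. In THIS file it is DERIVED: `flatBoarding_of_firstContact` (from the stub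
`FirstContact` and the proved `boardAtContact`). (= Sketch3.FlatBoarding; card anchor-and-board.) -/
def FlatBoarding : Prop :=
  ∀ (𝓢 : Spacetime.{0} 4) (O : Set 𝓢.carrier) (d : FinalStateDecomposition 𝓢 O 2)
    (R : Fin d.N → ℝ → ℝ) (R₀ : ℝ), Hc 𝓢 O 2 d R₀ → Sm 𝓢 O d R R₀ →
    ∀ τ₁ : ℝ, d.τ₀ < τ₁ → ∀ y : d.flatDomain, d.τ₀ < y.1 0 → y.1 0 ≤ τ₁ →
      d.flatChart y ∈ 𝓢.metric.causalPast 𝓢.timeOrientation (certifiedSlab d R τ₁)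

/-- **FIRST CONTACT** (the analytic core of BOARDING, isolated): for a flat-late point `Φ(y)` with
`τ₀ < y⁰ ≤ τ₁`, follow the `e₀`-ray `σ ↦ y + σ e₀`: EITHER it reaches the flat slab `{x⁰ = τ₁}` inside
`U` (so `Φ y ∈ J⁻(Φ(slab))`), OR there is a first parameter `u ∈ [0, τ₁ − y⁰]` at which the ray touches
a closed certified tube `{rₖ ≤ Rₖ(tₖ)}`; the contact point `c = y + u e₀` is still in `U` (before and
at contact SEAMED (8)-contrapositive gives `ρⱼ(x⁰) < rⱼ`, then the structure field
`setOf_lt_excision_subset_flatDomain`), `τ₀ < c⁰ ≤ τ₁`, `rₖ(c) ≤ Rₖ(tₖ(c))`, and `Φ y ≤ Φ c` by the flow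
(`line_mem_causalFuture` with HonestCore (d); `U` open supplies the parameter collar). Clauses:
Hc(d), Sm1 (continuity of `Rₖ`), Sm8, structure field. Size L: `IsClosed.csInf_mem` on `Icc`,
continuity of `σ ↦ rₖ(y + σe₀) − Rₖ(tₖ(y + σe₀))` (`Kerr.continuous_radius`, `continuous_poincareInv`),
openness collars. THE load-bearing use of the flat chart's time orientation sits here. -/
def FirstContact : Prop :=
  ∀ (𝓢 : Spacetime.{0} 4) (O : Set 𝓢.carrier) (d : FinalStateDecomposition 𝓢 O 2)
    (R : Fin d.N → ℝ → ℝ) (R₀ : ℝ), Hc 𝓢 O 2 d R₀ → Sm 𝓢 O d R R₀ →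
    ∀ τ₁ : ℝ, d.τ₀ < τ₁ → ∀ y : d.flatDomain, d.τ₀ < y.1 0 → y.1 0 ≤ τ₁ →
      d.flatChart y ∈ 𝓢.metric.causalPast 𝓢.timeOrientation
          (d.flatChart '' (Minkowski.backgroundOn d.flatDomain).timeSlab τ₁) ∨
      ∃ (c : d.flatDomain) (k : Fin d.N), d.τ₀ < c.1 0 ∧ c.1 0 ≤ τ₁ ∧
        (d.background k).radius c.1 ≤ R k ((d.background k).time c.1) ∧
        d.flatChart y ∈ 𝓢.metric.causalPast 𝓢.timeOrientation {d.flatChart c}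

/-- **REACH.** Every charted point outside the certified late region lies in
`J⁻(certifiedSlab d R τ₁)`. Routing by cases on a chart representative: flat-late `Φ y`:
`y⁰ ≤ τ₁` ⇒ BOARDING, `y⁰ > τ₁` ⇒ in `certifiedLate` (excluded); hole-late `Ψᵢ x` (`tᵢ > τ₀`):
`tᵢ < τ₁ ∧ rᵢ < Rᵢ(τ₁)` ⇒ ANCHORING (`holeAnchoring`, proved: Hc(b) at `ϱ = Rᵢ(τ₁)`);
`tᵢ = τ₁ ∧ rᵢ ≤ Rᵢ(τ₁)` ⇒ on the slab; `Rᵢ(tᵢ) ≤ rᵢ ≤ Rᵢ(tᵢ) + 1` (collar) ⇒ SEAMED (9) `tᵢ ≤ x⁰`,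
(8)-contrapositive & (12) ⇒ outside all flat tubes ⇒ ONE ATLAS (6): `Ψᵢ x = Φ x`, a flat-late point
(then as above); `rᵢ > Rᵢ(tᵢ) + 1` (far leaf) ⇒ SEAMED (10): in the radiation zone (flat-late, as
above); `tᵢ > τ₁ ∧ rᵢ ≤ Rᵢ(tᵢ)` ⇒ in `certifiedLate` (excluded). Clauses: Hc(b), Sm1, Sm6, Sm8, Sm9,
Sm10, Sm12, `FlatBoarding`. Size M. (= Sketch3.ChartedReach = Ideate1.DrainCharted = OneCurve
`ascent_K1`, `Iff.rfl`.) -/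
def ChartedReach : Prop :=
  ∀ (𝓢 : Spacetime.{0} 4) (O : Set 𝓢.carrier) (d : FinalStateDecomposition 𝓢 O 2)
    (R : Fin d.N → ℝ → ℝ) (R₀ : ℝ), Hc 𝓢 O 2 d R₀ → Sm 𝓢 O d R R₀ →
    ∀ τ₁ : ℝ, d.τ₀ < τ₁ →
      d.charted \ certifiedLate d R τ₁ ⊆
        𝓢.metric.causalPast 𝓢.timeOrientation (certifiedSlab d R τ₁)

/-- **FRONTIER.** The frontier of the (open) certified late region inside `O` lies in
`J⁻(certifiedSlab d R τ₁)`: `closure F = closure F₀ ∪ ⋃ⱼ closure Fⱼ` (finite union); a point of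
`closure F₀ ⊆ closure Φ{τ₁ ≤ y⁰}` is by SEAMED (11) either `Φ y` with `y⁰ ≥ τ₁` (`> τ₁`: in `F`,
excluded; `= τ₁`: flat slab) or a tube WALL `Ψⱼ x`, `x⁰ ≥ τ₁`, `rⱼ = ρⱼ(x⁰) ≥ R₀` (SEAMED (1)),
`rⱼ + 2 ≤ Rⱼ(tⱼ x)` (SEAMED (8)): `tⱼ > τ₁` ⇒ in `Fⱼ` (excluded), else RIDE (flat-late disjunct —
hole-EARLY walls included); a point of `closure Fⱼ ∩ O` is by HonestCore (c) (`τ' = τ₁`, `ϱ = Rⱼ`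
continuous) some `Ψⱼ x` with `tⱼ ≥ τ₁`, `rⱼ ≤ Rⱼ(tⱼ)`: `tⱼ = τ₁` ⇒ hole disc ⊆ slab, `tⱼ > τ₁` ⇒ in
`Fⱼ` (excluded). Clauses: Hc(c), Sm1, Sm8, Sm11, `TubeRide`. Size M.
(= Sketch3.FrontierBelowSlab ⟺ Ideate1.RimInclusion, `Triage3.rim_iff_frontier`.) -/
def FrontierBelowSlab : Prop :=
  ∀ (𝓢 : Spacetime.{0} 4) (O : Set 𝓢.carrier) (d : FinalStateDecomposition 𝓢 O 2)
    (R : Fin d.N → ℝ → ℝ) (R₀ : ℝ), Hc 𝓢 O 2 d R₀ → Sm 𝓢 O d R R₀ →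
    ∀ τ₁ : ℝ, d.τ₀ < τ₁ →
      (closure (certifiedLate d R τ₁) ∩ O) \ certifiedLate d R τ₁ ⊆
        𝓢.metric.causalPast 𝓢.timeOrientation (certifiedSlab d R τ₁)

/-! ## §3 The registered stubs (two). PROVED below and available to their provers: the RIDE
`tubeRide`, the hole ANCHORING `holeAnchoring`, BOARDING AT CONTACT `boardAtContact`,
`flatBoarding_of_firstContact : FirstContact → FlatBoarding`, and the routing
`chartedReach_of_boarding : FlatBoarding → ChartedReach`. -/

/-- **stub_firstContact** (hardest, L) — the flat `e₀`-ray up to first contact with the closed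
certified tubes (see `FirstContact` for the clause walk and the Lean cost). This is where
HonestCore (d) is consumed (`not_flatBoarding_without_orientation`). -/
theorem stub_firstContact : FirstContact := by
  sorry

/-- **stub_frontier** (M) — closure clauses SEAMED (11) and HonestCore (c) enumerate the frontier
points of the certified late region inside `O`; the only non-trivial class (flat-tube walls,
hole-early allowed) rides to the disc by `tubeRide` via SEAMED (1), (8) (see `FrontierBelowSlab`). -/
theorem stub_frontier : FrontierBelowSlab := by
  sorry

/-! ### Name-keyed aliases of the two stub statements (the hypotheses of the composition: the skeleton
audit admits a hypothesis only if its head constant is a registered obligation or is named like a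
declared stub; `Registered.stub_X` unfolds reducibly to the statement of `stub_X`) -/
namespace Registered

/-- Alias of `FirstContact`, keyed by the registered stub name `stub_firstContact`. -/
abbrev stub_firstContact : Prop := FirstContact
/-- Alias of `FrontierBelowSlab`, keyed by the registered stub name `stub_frontier`. -/
abbrev stub_frontier : Prop := FrontierBelowSlab

end Registered

/-- Consistency: the name-keyed alias IS the stub statement (definitionally). -/
theorem registered_firstContact_iff : Registered.stub_firstContact ↔ FirstContact := Iff.rfl
/-- Consistency: the name-keyed alias IS the stub statement (definitionally). -/
theorem registered_frontier_iff : Registered.stub_frontier ↔ FrontierBelowSlab := Iff.rfl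

/-! ## §4 Proved glue -/

/-- `certifiedLate ⊆ charted` for `τ₁ > τ₀`. (Triage3) -/
theorem certifiedLate_subset_charted {𝓢 : Spacetime.{0} 4} {O : Set 𝓢.carrier}
    (d : FinalStateDecomposition 𝓢 O 2) (R : Fin d.N → ℝ → ℝ) {τ₁ : ℝ} (hτ₁ : d.τ₀ < τ₁) :
    certifiedLate d R τ₁ ⊆ d.charted := by
  rintro z (⟨y, hy, rfl⟩ | hz)
  · exact d.radiationZone_subset_charted ⟨y, lt_trans hτ₁ hy, rfl⟩
  · obtain ⟨i, x, hx, rfl⟩ := Set.mem_iUnion.mp hz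
    exact d.region_subset_charted i ⟨x, lt_trans hτ₁ hx.1, rfl⟩

/-- Images of open subsets of the late region under a late chart are open. (Sketch3) -/
theorem isOpen_image_of_isLateChart {𝓢 : Spacetime.{0} 4} {B : ModelBackground}
    {𝒟 : Set 𝓢.carrier} {τ₀ : ℝ} {Ψ : B.domain → 𝓢.carrier} (hΨ : 𝓢.IsLateChart B 𝒟 τ₀ Ψ)
    {U : Set B.domain} (hU : IsOpen U) (hUl : U ⊆ B.lateRegion τ₀) : IsOpen (Ψ '' U) := by
  have h := hΨ.isOpenEmbedding.isOpenMap (Subtype.val ⁻¹' U) (hU.preimage continuous_subtype_val)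
  have hEq : (B.lateRegion τ₀).restrict Ψ '' (Subtype.val ⁻¹' U) = Ψ '' U := by
    ext z
    constructor
    · rintro ⟨⟨x, hxl⟩, hxU, rfl⟩
      exact ⟨x, hxU, rfl⟩
    · rintro ⟨x, hxU, rfl⟩
      exact ⟨⟨x, hUl hxU⟩, hxU, rfl⟩
  rw [← hEq]
  exact h

/-- **The certified late region is open** under SEAMED: lateral walls `rⱼ = Rⱼ(tⱼ)`, `tⱼ > τ₁` are
flat-late interior points (one atlas (6) ⇐ clock lag (9), margin (8), disjointness (12)).
(Sketch3.certifiedLateIsOpen_holds) -/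
theorem isOpen_certifiedLate (𝓢 : Spacetime.{0} 4) (O : Set 𝓢.carrier)
    (d : FinalStateDecomposition 𝓢 O 2) (R : Fin d.N → ℝ → ℝ) (R₀ : ℝ) (hs : Sm 𝓢 O d R R₀)
    (τ₁ : ℝ) (hτ₁ : d.τ₀ < τ₁) : IsOpen (certifiedLate d R τ₁) := by
  obtain ⟨hS1, -, -, -, -, hS6, -, hS8, hS9, -, -, hS12⟩ := hs
  have hc0 : Continuous fun y : E4 ↦ y 0 := PiLp.continuous_apply 2 _ 0
  have ht : ∀ i, Continuous fun x : E4 ↦ (d.background i).time x := fun i ↦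
    hc0.comp (continuous_poincareInv _ _)
  have hr : ∀ i, Continuous fun x : E4 ↦ (d.background i).radius x := fun i ↦
    (Kerr.continuous_radius _).comp (continuous_poincareInv _ _)
  have hF₀ : IsOpen (d.flatChart '' (Minkowski.backgroundOn d.flatDomain).lateRegion τ₁) := by
    refine isOpen_image_of_isLateChart d.isLateChart_flat ?_ fun y hy ↦ lt_trans hτ₁ hy
    exact isOpen_lt continuous_const (hc0.comp continuous_subtype_val)
  have hFi : ∀ i, IsOpen (d.chart i '' {x | τ₁ < (d.background i).time x.1 ∧
      (d.background i).radius x.1 < R i ((d.background i).time x.1)}) := by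
    intro i
    refine isOpen_image_of_isLateChart (d.isLateChart i) ?_ fun x hx ↦ lt_trans hτ₁ hx.1
    exact (isOpen_lt continuous_const ((ht i).comp continuous_subtype_val)).and
      (isOpen_lt ((hr i).comp continuous_subtype_val)
        ((hS1 i).2.1.comp ((ht i).comp continuous_subtype_val)))
  have hEq : certifiedLate d R τ₁ =
      d.flatChart '' (Minkowski.backgroundOn d.flatDomain).lateRegion τ₁ ∪
        ⋃ i, d.chart i '' {x | τ₁ < (d.background i).time x.1 ∧
          (d.background i).radius x.1 < R i ((d.background i).time x.1)} := by
    refine Set.Subset.antisymm ?_ ?_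
    · rintro z (hz | hz)
      · exact Or.inl hz
      · obtain ⟨j, x, ⟨hxt, hxr⟩, rfl⟩ := Set.mem_iUnion.mp hz
        rcases lt_or_eq_of_le hxr with hlt | heq
        · exact Or.inr (Set.mem_iUnion.mpr ⟨j, x, ⟨hxt, hlt⟩, rfl⟩)
        · left
          have hτ₀t : d.τ₀ ≤ (d.background j).time x.1 := (lt_trans hτ₁ hxt).le
          have hlag : (d.background j).time x.1 ≤ x.1 0 := hS9 j x.1 hτ₀t (by linarith)
          have hτ₀y : d.τ₀ ≤ x.1 0 := by linarith
          have hout : ∀ k, d.excision k (x.1 0) < (d.background k).radius x.1 := by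
            intro k
            by_contra hk
            push Not at hk
            have h8 : (d.background k).radius x.1 + 2 ≤ R k ((d.background k).time x.1) :=
              hS8 k x.1 hτ₀y hk
            rcases eq_or_ne k j with rfl | hkj
            · linarith
            · have h12 : R k ((d.background k).time x.1) + 1 < (d.background k).radius x.1 :=
                hS12 j k x.1 (Ne.symm hkj) (Or.inl hτ₀y) (by linarith)
              linarith
          obtain ⟨hy', hEqΦ⟩ := hS6 j x.1 x.2 hτ₀y hout (by linarith)
          refine ⟨⟨x.1, hy'⟩, ?_, ?_⟩
          · show τ₁ < x.1 0
            linarith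
          · rw [← hEqΦ]
    · rintro z (hz | hz)
      · exact Or.inl hz
      · obtain ⟨j, x, ⟨hxt, hxr⟩, rfl⟩ := Set.mem_iUnion.mp hz
        exact Or.inr (Set.mem_iUnion.mpr ⟨j, x, ⟨hxt, hxr.le⟩, rfl⟩)
  rw [hEq]
  exact hF₀.union (isOpen_iUnion hFi)

/-- **Abstract first-entry covering lemma** (metric-free; Sketch3.firstEntryCovering_holds): if `F`
is open, `F ⊆ C ⊆ O ⊆ I⁻(C)`, `O` is diamond-convex, `C \ F ⊆ J⁻(S)` and `(closure F ∩ O) \ F ⊆ J⁻(S)`,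
then `O \ F ⊆ J⁻(S)`. First entry = `sInf` of the parameters mapped into `F` along ONE timelike curve
(differentiable on `Icc`, no limit curves). -/
theorem firstEntryCovering (𝓢 : Spacetime.{0} 4) (O C F S : Set 𝓢.carrier)
    (hF : IsOpen F) (hFC : F ⊆ C) (hCO : C ⊆ O)
    (hOI : O ⊆ 𝓢.metric.chronologicalPast 𝓢.timeOrientation C)
    (hconv : ∀ p ∈ O, ∀ q ∈ O, 𝓢.metric.causalFuture 𝓢.timeOrientation {p} ∩
        𝓢.metric.causalPast 𝓢.timeOrientation {q} ⊆ O)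
    (hCF : C \ F ⊆ 𝓢.metric.causalPast 𝓢.timeOrientation S)
    (hfront : (closure F ∩ O) \ F ⊆ 𝓢.metric.causalPast 𝓢.timeOrientation S) :
    O \ F ⊆ 𝓢.metric.causalPast 𝓢.timeOrientation S := by
  intro p hp
  obtain ⟨hpO, hpF⟩ := hp
  have hn2 : (2 : WithTop ℕ∞) ≤ ((⊤ : ℕ∞) : WithTop ℕ∞) := WithTop.coe_le_coe.mpr le_top
  have hJJ : ∀ {x y : 𝓢.carrier}, x ∈ 𝓢.metric.causalPast 𝓢.timeOrientation {y} →
      y ∈ 𝓢.metric.causalPast 𝓢.timeOrientation S →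
      x ∈ 𝓢.metric.causalPast 𝓢.timeOrientation S := by
    intro x y hxy hyS
    have h : x ∈ 𝓢.metric.causalFuture 𝓢.timeOrientation.reverse
        (𝓢.metric.causalFuture 𝓢.timeOrientation.reverse S) :=
      LorentzianMetric.causalFuture_mono (Set.singleton_subset_iff.mpr hyS) hxy
    rw [LorentzianMetric.causalFuture_causalFuture_eq hn2] at h
    exact h
  have hpI : p ∈ 𝓢.metric.chronologicalFuture 𝓢.timeOrientation.reverse C := hOI hpO
  rw [LorentzianMetric.chronologicalFuture_eq_biUnion] at hpI
  simp only [Set.mem_iUnion, exists_prop] at hpI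
  obtain ⟨c, hcC, hpc⟩ := hpI
  by_cases hcF : c ∈ F
  swap
  · exact hJJ (LorentzianMetric.chronologicalFuture_subset_causalFuture 𝓢.metric
      𝓢.timeOrientation.reverse {c} hpc) (hCF ⟨hcC, hcF⟩)
  have hcp : c ∈ 𝓢.metric.chronologicalFuture 𝓢.timeOrientation {p} :=
    LorentzianMetric.mem_chronologicalFuture_of_mem_chronologicalPast hpc
  obtain ⟨p', hp', γ, a, b, hab, hγ, hγa, hγb⟩ := hcp
  rw [Set.mem_singleton_iff] at hp'
  have hγa' : γ a = p := hγa.trans hp'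
  have hγc : ∀ s ∈ Set.Icc a b, ContinuousAt γ s := fun s hs ↦ (hγ s hs).1.continuousAt
  let A : Set ℝ := {s | s ∈ Set.Icc a b ∧ γ s ∈ F}
  have hbA : b ∈ A := ⟨Set.right_mem_Icc.mpr hab.le, by show γ b ∈ F; rw [hγb]; exact hcF⟩
  have hAne : A.Nonempty := ⟨b, hbA⟩
  have hAbdd : BddBelow A := ⟨a, fun s hs ↦ hs.1.1⟩
  have hs₀b : sInf A ≤ b := csInf_le hAbdd hbA
  have has₀ : a ≤ sInf A := le_csInf hAne fun s hs ↦ hs.1.1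
  have hs₀I : sInf A ∈ Set.Icc a b := ⟨has₀, hs₀b⟩
  have hcl : γ (sInf A) ∈ closure F := by
    have h1 : sInf A ∈ closure A := csInf_mem_closure hAne hAbdd
    have h2 : γ (sInf A) ∈ closure (γ '' A) :=
      ContinuousWithinAt.mem_closure_image (hγc _ hs₀I).continuousWithinAt h1
    refine closure_mono ?_ h2
    rintro _ ⟨s, hs, rfl⟩
    exact hs.2
  have hnF : γ (sInf A) ∉ F := by
    intro hF₀
    have hne : a ≠ sInf A := by
      intro h
      rw [← h, hγa'] at hF₀
      exact hpF hF₀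
    have has₀' : a < sInf A := lt_of_le_of_ne has₀ hne
    have hnhds : γ ⁻¹' F ∈ 𝓝 (sInf A) := (hγc _ hs₀I).preimage_mem_nhds (hF.mem_nhds hF₀)
    obtain ⟨ε, hε, hball⟩ := Metric.mem_nhds_iff.mp hnhds
    obtain ⟨s₁, hs₁a, hs₁ε, hs₁lt⟩ : ∃ s₁, a ≤ s₁ ∧ sInf A - ε / 2 ≤ s₁ ∧ s₁ < sInf A :=
      ⟨max a (sInf A - ε / 2), le_max_left _ _, le_max_right _ _, max_lt has₀' (by linarith)⟩
    have hs₁A : s₁ ∈ A := by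
      refine ⟨⟨hs₁a, hs₁lt.le.trans hs₀b⟩, ?_⟩
      apply hball
      rw [Metric.mem_ball, Real.dist_eq, abs_sub_lt_iff]
      constructor <;> linarith
    exact absurd (csInf_le hAbdd hs₁A) (not_le.mpr hs₁lt)
  have hps₀ : p ∈ 𝓢.metric.causalPast 𝓢.timeOrientation {γ (sInf A)} := by
    rcases eq_or_lt_of_le has₀ with h | h
    · rw [← h, hγa']
      exact LorentzianMetric.subset_causalPast _ _ _ (Set.mem_singleton p)
    · exact LorentzianMetric.mem_causalPast_singleton_iff.mpr (Or.inr ⟨p, Set.mem_singleton p,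
        γ, a, sInf A, h, (hγ.mono (Set.Icc_subset_Icc le_rfl hs₀b)).isFutureCausalCurveOn,
        hγa', rfl⟩)
  have hs₀c : γ (sInf A) ∈ 𝓢.metric.causalPast 𝓢.timeOrientation {c} := by
    rcases eq_or_lt_of_le hs₀b with h | h
    · rw [h, hγb]
      exact LorentzianMetric.subset_causalPast _ _ _ (Set.mem_singleton c)
    · exact LorentzianMetric.mem_causalPast_singleton_iff.mpr (Or.inr ⟨γ (sInf A),
        Set.mem_singleton _, γ, sInf A, b, h,
        (hγ.mono (Set.Icc_subset_Icc has₀ le_rfl)).isFutureCausalCurveOn, rfl, hγb⟩)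
  have hs₀O : γ (sInf A) ∈ O :=
    hconv p hpO c (hCO hcC) ⟨LorentzianMetric.mem_causalPast_singleton_iff.mp hps₀, hs₀c⟩
  exact hJJ hps₀ (hfront ⟨⟨hcl, hs₀O⟩, hnF⟩)

/-- **Hole anchoring at the slab radius** (PROVED; Sketch3.holeAnchoring_holds = Ideate1.WideAnchoring):
a hole-charted point with hole time in `(τ₀, τ₁)` and radius `< Rⱼ(τ₁)` lies in `J⁻(certifiedSlab)` —
HonestCore (b) with `ϱ = Rⱼ(τ₁) ≥ R₀` (SEAMED (1)), `τ₂ = τ₁`. The flow-free half of REACH. -/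
theorem holeAnchoring (𝓢 : Spacetime.{0} 4) (O : Set 𝓢.carrier) (d : FinalStateDecomposition 𝓢 O 2)
    (R : Fin d.N → ℝ → ℝ) (R₀ : ℝ) (hc : Hc 𝓢 O 2 d R₀) (hs : Sm 𝓢 O d R R₀)
    (τ₁ : ℝ) (hτ₁ : d.τ₀ < τ₁) (j : Fin d.N) (x : (d.background j).domain)
    (ht₀ : d.τ₀ < (d.background j).time x.1) (ht₁ : (d.background j).time x.1 < τ₁)
    (hr : (d.background j).radius x.1 < R j τ₁) :
    d.chart j x ∈ 𝓢.metric.causalPast 𝓢.timeOrientation (certifiedSlab d R τ₁) := by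
  obtain ⟨-, hanchor, -, -⟩ := hc
  obtain ⟨hrad, -⟩ := hs
  have hR₀ : R₀ ≤ R j τ₁ := by linarith [((hrad j).2.2 τ₁).1]
  have hx : d.chart j x ∈ d.chart j '' {x | d.τ₀ < (d.background j).time x.1 ∧
      (d.background j).time x.1 < τ₁ ∧ (d.background j).radius x.1 < R j τ₁} :=
    ⟨x, ⟨ht₀, ht₁, hr⟩, rfl⟩
  have h1 := hanchor j (R j τ₁) τ₁ hR₀ hτ₁ hx
  refine LorentzianMetric.causalFuture_mono ?_ h1
  intro z hz
  exact Set.mem_union_right _ (Set.mem_iUnion.mpr ⟨j, hz⟩)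

section Flow

variable {𝓢 : Spacetime.{0} 4}

/-- **Coordinate lines through a chart are causal curves** (Disproof.lean §4, verbatim): for
`Φ : U → 𝓢` smooth on an open `U ⊆ E4`, `v ∈ E4`, if the segment `σ ↦ y + σ v`, `σ ∈ [−ε, s + ε]`, lies
in `U` and `dΦ(v)` is future-directed causal along `σ ∈ [0, s]`, then `Φ(y) ≤ Φ(y + s v)`. (The
parameter is clamped to get a globally defined curve differentiable on the CLOSED interval `[0, s]`.)
The adapter for the RIDE (`v = Λⱼe₀`, `Φ = Ψⱼ`) and for BOARDING (`v = e₀`, `Φ` the flat chart). -/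
theorem line_mem_causalFuture {U : Opens E4} {Φ : U → 𝓢.carrier}
    (hΦ : ContMDiff 𝓘(ℝ, E4) (𝓡 4) ∞ Φ) (v y : E4) (hy : y ∈ U) {s ε : ℝ} (hs : 0 ≤ s) (hε : 0 < ε)
    (hmem : ∀ σ ∈ Icc (-ε) (s + ε), y + σ • v ∈ U)
    (hfut : ∀ z : U, z.1 ∈ (fun σ : ℝ ↦ y + σ • v) '' Icc 0 s →
      𝓢.timeOrientation.IsFutureDirected (mfderiv 𝓘(ℝ, E4) (𝓡 4) Φ z v)) :
    Φ ⟨y + s • v, hmem s ⟨by linarith, by linarith⟩⟩ ∈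
      𝓢.metric.causalFuture 𝓢.timeOrientation {Φ ⟨y, hy⟩} := by
  rcases hs.eq_or_lt with hs0 | hs'
  · subst hs0
    have : (⟨y + (0 : ℝ) • v, hmem 0 ⟨by linarith, by linarith⟩⟩ : U) = ⟨y, hy⟩ := Subtype.ext (by simp)
    rw [this]
    exact Or.inl rfl
  set c : ℝ → ℝ := fun σ ↦ max (-ε) (min σ (s + ε)) with hc
  have hcmem : ∀ σ, c σ ∈ Icc (-ε) (s + ε) := fun σ ↦
    ⟨le_max_left _ _, max_le (by linarith) (min_le_right _ _)⟩
  have hcid : ∀ σ ∈ Ioo (-ε) (s + ε), c σ = σ := fun σ hσ ↦ by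
    simp only [hc]
    rw [min_eq_left hσ.2.le, max_eq_right hσ.1.le]
  set ι : ℝ → U := fun σ ↦ ⟨y + c σ • v, hmem (c σ) (hcmem σ)⟩ with hι
  have hιval : ∀ σ, (ι σ).1 = y + c σ • v := fun σ ↦ rfl
  set γ : ℝ → 𝓢.carrier := fun σ ↦ Φ (ι σ) with hγ
  have hι0 : ι 0 = ⟨y, hy⟩ := Subtype.ext (by
    rw [hιval, hcid 0 ⟨by linarith, by linarith⟩]; simp)
  have hιs : ι s = ⟨y + s • v, hmem s ⟨by linarith, by linarith⟩⟩ := Subtype.ext (by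
    rw [hιval, hcid s ⟨by linarith, by linarith⟩])
  refine Or.inr ⟨Φ ⟨y, hy⟩, rfl, γ, 0, s, hs', ?_, ?_, ?_⟩
  · intro t ht
    have htI : t ∈ Ioo (-ε) (s + ε) := ⟨by linarith [ht.1], by linarith [ht.2]⟩
    have hev : ∀ᶠ σ in 𝓝 t, c σ = σ :=
      Filter.eventually_of_mem (isOpen_Ioo.mem_nhds htI) fun σ hσ ↦ hcid σ hσ
    have hval : (Subtype.val ∘ ι) =ᶠ[𝓝 t] fun σ : ℝ ↦ y + σ • v :=
      hev.mono fun σ hσ ↦ by simp only [Function.comp_apply, hιval, hσ]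
    have haff : ContMDiff 𝓘(ℝ, ℝ) 𝓘(ℝ, E4) ∞ (fun σ : ℝ ↦ y + σ • v) :=
      (contDiff_const.add (contDiff_id.smul contDiff_const)).contMDiff
    have hιs' : ContMDiffAt 𝓘(ℝ, ℝ) 𝓘(ℝ, E4) ∞ ι t := by
      rw [← ContMDiffAt.subtypeVal_comp_iff]
      exact haff.contMDiffAt.congr_of_eventuallyEq hval
    have hιd : MDifferentiableAt 𝓘(ℝ, ℝ) 𝓘(ℝ, E4) ι t := hιs'.mdifferentiableAt (by simp)
    have hΦd : MDifferentiableAt 𝓘(ℝ, E4) (𝓡 4) Φ (ι t) := hΦ.mdifferentiableAt (by simp)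
    have hγd : MDifferentiableAt 𝓘(ℝ, ℝ) (𝓡 4) γ t := hΦd.comp t hιd
    have hder : HasDerivAt (fun σ : ℝ ↦ y + σ • v) v t := by
      simpa using ((hasDerivAt_id t).smul_const v).const_add y
    have h3 : mfderiv 𝓘(ℝ, ℝ) 𝓘(ℝ, E4) (fun σ : ℝ ↦ y + σ • v) t (1 : ℝ) = v := by
      rw [mfderiv_eq_fderiv]
      change fderiv ℝ (fun σ : ℝ ↦ y + σ • v) t 1 = v
      rw [hder.hasFDerivAt.fderiv]
      simp
    have hvι : mfderiv 𝓘(ℝ, ℝ) 𝓘(ℝ, E4) ι t (1 : ℝ) = v := by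
      have h1 : mfderiv 𝓘(ℝ, ℝ) 𝓘(ℝ, E4) (Subtype.val ∘ ι) t =
          (mfderiv 𝓘(ℝ, E4) 𝓘(ℝ, E4) (Subtype.val : U → E4) (ι t)).comp
            (mfderiv 𝓘(ℝ, ℝ) 𝓘(ℝ, E4) ι t) :=
        mfderiv_comp t
          ((contMDiff_subtype_val : ContMDiff 𝓘(ℝ, E4) 𝓘(ℝ, E4) ∞ (Subtype.val : U → E4)).mdifferentiableAt
            (by simp)) hιd
      have h2 : mfderiv 𝓘(ℝ, ℝ) 𝓘(ℝ, E4) (Subtype.val ∘ ι) t =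
          mfderiv 𝓘(ℝ, ℝ) 𝓘(ℝ, E4) (fun σ : ℝ ↦ y + σ • v) t := hval.mfderiv_eq
      have h4 : (mfderiv 𝓘(ℝ, E4) 𝓘(ℝ, E4) (Subtype.val : U → E4) (ι t))
          ((mfderiv 𝓘(ℝ, ℝ) 𝓘(ℝ, E4) ι t) (1 : ℝ)) =
          (mfderiv 𝓘(ℝ, ℝ) 𝓘(ℝ, E4) (fun σ : ℝ ↦ y + σ • v) t) (1 : ℝ) := by
        have := congrArg (fun L ↦ L (1 : ℝ)) h1
        rw [h2] at this
        exact this.symm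
      rw [h3, OpensChart.mfderiv_subtypeVal_apply] at h4
      exact h4
    have hvel : velocity (𝓡 4) γ t = mfderiv 𝓘(ℝ, E4) (𝓡 4) Φ (ι t) v := by
      unfold velocity
      rw [show γ = Φ ∘ ι from rfl, mfderiv_comp t hΦd hιd]
      show (mfderiv 𝓘(ℝ, E4) (𝓡 4) Φ (ι t)) ((mfderiv 𝓘(ℝ, ℝ) 𝓘(ℝ, E4) ι t) (1 : ℝ)) = _
      rw [hvι]
    refine ⟨hγd, ?_⟩
    rw [hvel]
    refine hfut (ι t) ⟨c t, ?_, (hιval t).symm⟩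
    rw [hcid t htI]
    exact ht
  · show Φ (ι 0) = Φ ⟨y, hy⟩
    rw [hι0]
  · show Φ (ι s) = Φ ⟨y + s • v, hmem s ⟨by linarith, by linarith⟩⟩
    rw [hιs]

end Flow

/-! ### Ride kinematics (cf. triage-1 scratch `RideKinematics.lean`): along `u ↦ x + u • Λ e₀` the
rest-frame coordinates shift by `u • e₀` — hole clock `+u`, rest-frame Kerr–Schild radius constant,
lab clock `+u (Λe₀)⁰`; the segment never leaves the boosted Kerr exterior. -/

section Kinematics

/-- `E4.spatial e₀ = 0`. -/
theorem spatial_basisVector_zero : E4.spatial (E4.basisVector 0 : E4) = 0 := by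
  ext i
  simp [E4.spatial_apply, Fin.succ_ne_zero]

/-- `poincareInv (Λ, c) (x + u Λe₀) = poincareInv (Λ, c) x + u e₀` (affine map, `Λ⁻¹Λ = 1`). -/
theorem poincareInv_add_smul (Λ : lorentzGroup) (c x : E4) (u : ℝ) :
    poincareInv Λ c (x + u • (Λ : E4 ≃L[ℝ] E4) (E4.basisVector 0)) =
      poincareInv Λ c x + u • E4.basisVector 0 := by
  unfold poincareInv
  rw [show x + u • (Λ : E4 ≃L[ℝ] E4) (E4.basisVector 0) - c =
      (x - c) + u • (Λ : E4 ≃L[ℝ] E4) (E4.basisVector 0) by abel]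
  rw [map_add, map_smul, ContinuousLinearEquiv.symm_apply_apply]

/-- Hole clock along the ride: `t*(x + u Λe₀) = t*(x) + u`. -/
theorem time_add_smul (Λ : lorentzGroup) (c : E4) (M a : ℝ) (x : E4) (u : ℝ) :
    (boostedKerrBackground Λ c M a).time (x + u • (Λ : E4 ≃L[ℝ] E4) (E4.basisVector 0)) =
      (boostedKerrBackground Λ c M a).time x + u := by
  show poincareInv Λ c (x + u • (Λ : E4 ≃L[ℝ] E4) (E4.basisVector 0)) 0 = poincareInv Λ c x 0 + u
  rw [poincareInv_add_smul]
  simp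

/-- Rest-frame radius along the ride: constant. -/
theorem radius_add_smul (Λ : lorentzGroup) (c : E4) (M a : ℝ) (x : E4) (u : ℝ) :
    (boostedKerrBackground Λ c M a).radius (x + u • (Λ : E4 ≃L[ℝ] E4) (E4.basisVector 0)) =
      (boostedKerrBackground Λ c M a).radius x := by
  show Kerr.radius a (poincareInv Λ c (x + u • (Λ : E4 ≃L[ℝ] E4) (E4.basisVector 0))) =
    Kerr.radius a (poincareInv Λ c x)
  rw [poincareInv_add_smul]
  refine Kerr.radius_eq_of_spatial_eq a ?_
  rw [map_add, map_smul, spatial_basisVector_zero, smul_zero, add_zero]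

/-- The ride never leaves the chart domain (the domain is `{r > max r₊ 0}`, `r` is constant). -/
theorem mem_domain_add_smul (Λ : lorentzGroup) (c : E4) (M a : ℝ) {x : E4}
    (hx : x ∈ (boostedKerrBackground Λ c M a).domain) (u : ℝ) :
    x + u • (Λ : E4 ≃L[ℝ] E4) (E4.basisVector 0) ∈ (boostedKerrBackground Λ c M a).domain := by
  change x + u • (Λ : E4 ≃L[ℝ] E4) (E4.basisVector 0) ∈ boostedKerrExterior Λ c M a
  have hx' : x ∈ boostedKerrExterior Λ c M a := hx
  rw [mem_boostedKerrExterior, Kerr.mem_exterior] at hx' ⊢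
  have := radius_add_smul Λ c M a x u
  change Kerr.radius a (poincareInv Λ c (x + u • (Λ : E4 ≃L[ℝ] E4) (E4.basisVector 0))) =
    Kerr.radius a (poincareInv Λ c x) at this
  rw [this]
  exact hx'

/-- Lab clock along the ride: `(x + u Λe₀)⁰ = x⁰ + u (Λe₀)⁰`. -/
theorem coord0_add_smul (Λ : lorentzGroup) (x : E4) (u : ℝ) :
    (x + u • (Λ : E4 ≃L[ℝ] E4) (E4.basisVector 0)) 0 =
      x 0 + u * (Λ : E4 ≃L[ℝ] E4) (E4.basisVector 0) 0 := by
  simp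

end Kinematics

/-! ### The ride, PROVED (shared lemma of all six round-1 cards: Sketch3.TubeRide = OneCurve
`escalator` ⇒ `Triage3.tubeRide_of_escalator`; here a theorem, so it is NOT a stub of this line) -/

/-- **`TubeRide` holds.** Along `u ↦ Ψⱼ(x + u Λⱼe₀)`, `u ∈ [0, τ₁ − tⱼ(x)]`: the rest-frame radius is
constant (`radius_add_smul`), the hole clock is `tⱼ(x) + u` (`time_add_smul`), the lab clock is
`x⁰ + u (Λⱼe₀)⁰ ≥ x⁰` (HonestCore (a): orthochronous), so the SEAMED (5) window
`(τ₀ ≤ t ∨ τ₀ ≤ x⁰) ∧ R₀ ≤ r ≤ Rⱼ(t)` persists (`R` monotone, SEAMED (1)) and `dΨⱼ(Λⱼe₀)` is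
future-directed all along; `line_mem_causalFuture` makes the segment a causal curve, and its endpoint
lies on `truncTimeSlab (Rⱼ τ₁) τ₁ ⊆ certifiedSlab d R τ₁`. Clauses used: Hc(a)-orth, Sm1-mono, Sm5. -/
theorem tubeRide : TubeRide := by
  intro 𝓢 O d R R₀ hc hs τ₁ hτ₁ j x hlate hr₀ hrR ht
  obtain ⟨ha, -, -, -⟩ := hc
  obtain ⟨h1, -, -, -, h5, -⟩ := hs
  have horth : 0 < ((d.motion j).1 : E4 ≃L[ℝ] E4) (E4.basisVector 0) 0 := (ha j).2.2
  have hmono : Monotone (R j) := (h1 j).1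
  -- kinematics along the ride (the background of hole `j` is `boostedKerrBackground Λⱼ cⱼ Mⱼ aⱼ`)
  have htime : ∀ σ : ℝ, (d.background j).time
      (x.1 + σ • ((d.motion j).1 : E4 ≃L[ℝ] E4) (E4.basisVector 0)) = (d.background j).time x.1 + σ :=
    fun σ ↦ time_add_smul (d.motion j).1 (d.motion j).2 (d.mass j) (d.spin j) x.1 σ
  have hrad : ∀ σ : ℝ, (d.background j).radius
      (x.1 + σ • ((d.motion j).1 : E4 ≃L[ℝ] E4) (E4.basisVector 0)) = (d.background j).radius x.1 :=
    fun σ ↦ radius_add_smul (d.motion j).1 (d.motion j).2 (d.mass j) (d.spin j) x.1 σ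
  have hmem : ∀ σ : ℝ,
      x.1 + σ • ((d.motion j).1 : E4 ≃L[ℝ] E4) (E4.basisVector 0) ∈ (d.background j).domain :=
    fun σ ↦ mem_domain_add_smul (d.motion j).1 (d.motion j).2 (d.mass j) (d.spin j) x.2 σ
  set s : ℝ := τ₁ - (d.background j).time x.1 with hsdef
  have hs0 : 0 ≤ s := by rw [hsdef]; linarith
  -- the co-moving segment is a causal curve: SEAMED (5) along it
  have hflow := line_mem_causalFuture (𝓢 := 𝓢) (d.isLateChart j).contMDiff
    (((d.motion j).1 : E4 ≃L[ℝ] E4) (E4.basisVector 0)) x.1 x.2 hs0 one_pos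
    (fun σ _ ↦ hmem σ) (by
      rintro z ⟨σ, hσ, hzσ⟩
      obtain rfl : z = ⟨_, hmem σ⟩ := Subtype.ext hzσ.symm
      have hσ0 : 0 ≤ σ := hσ.1
      refine h5 j _ ?_ ?_ ?_
      · show d.τ₀ ≤ (d.background j).time (x.1 + σ • ((d.motion j).1 : E4 ≃L[ℝ] E4) (E4.basisVector 0)) ∨
          d.τ₀ ≤ (x.1 + σ • ((d.motion j).1 : E4 ≃L[ℝ] E4) (E4.basisVector 0)) 0
        rcases hlate with hl | hl
        · left
          rw [htime]
          linarith
        · right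
          rw [coord0_add_smul]
          have := mul_nonneg hσ0 horth.le
          linarith
      · show R₀ ≤ (d.background j).radius (x.1 + σ • ((d.motion j).1 : E4 ≃L[ℝ] E4) (E4.basisVector 0))
        rw [hrad]
        exact hr₀
      · show (d.background j).radius (x.1 + σ • ((d.motion j).1 : E4 ≃L[ℝ] E4) (E4.basisVector 0)) ≤
          R j ((d.background j).time (x.1 + σ • ((d.motion j).1 : E4 ≃L[ℝ] E4) (E4.basisVector 0)))
        rw [hrad, htime]
        exact hrR.trans (hmono (by linarith)))
  -- the endpoint lies on the hole disc `{tⱼ = τ₁, rⱼ ≤ Rⱼ(τ₁)}` of the certified slab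
  have hslab : (⟨x.1 + s • ((d.motion j).1 : E4 ≃L[ℝ] E4) (E4.basisVector 0), hmem s⟩ :
      (d.background j).domain) ∈ (d.background j).truncTimeSlab (R j τ₁) τ₁ := by
    refine ⟨?_, ?_⟩
    · show (d.background j).time (x.1 + s • ((d.motion j).1 : E4 ≃L[ℝ] E4) (E4.basisVector 0)) = τ₁
      rw [htime, hsdef]
      ring
    · show (d.background j).radius (x.1 + s • ((d.motion j).1 : E4 ≃L[ℝ] E4) (E4.basisVector 0)) ≤
        R j τ₁
      rw [hrad]
      exact hrR.trans (hmono ht)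
  have hS : d.chart j ⟨x.1 + s • ((d.motion j).1 : E4 ≃L[ℝ] E4) (E4.basisVector 0), hmem s⟩ ∈
      certifiedSlab d R τ₁ :=
    Or.inr (mem_iUnion.mpr ⟨j, _, hslab, rfl⟩)
  have hpx : d.chart j x ∈ 𝓢.metric.causalPast 𝓢.timeOrientation
      {d.chart j ⟨x.1 + s • ((d.motion j).1 : E4 ≃L[ℝ] E4) (E4.basisVector 0), hmem s⟩} :=
    LorentzianMetric.mem_causalPast_of_mem_causalFuture hflow
  exact LorentzianMetric.causalFuture_mono (singleton_subset_iff.mpr hS) hpx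

/-! ### BOARDING from FIRST CONTACT, PROVED -/

/-- `r₊(M, a) = M + √(M² − a²) ≤ 2M` for `0 ≤ M`. (Disproof.lean) -/
theorem rPlus_le_two_mul {M : ℝ} (hM : 0 ≤ M) (a : ℝ) : Kerr.rPlus M a ≤ 2 * M := by
  unfold Kerr.rPlus
  have h1 : √(M ^ 2 - a ^ 2) ≤ √(M ^ 2) := Real.sqrt_le_sqrt (by nlinarith [sq_nonneg a])
  rw [Real.sqrt_sq hM] at h1
  linarith

/-- **Boarding at a contact point** (PROVED): a flat-late point `Φ(c)`, `τ₀ < c⁰ ≤ τ₁`, lying in a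
closed certified tube `rₖ(c) ≤ Rₖ(tₖ(c))` is in `J⁻(certifiedSlab d R τ₁)`: SEAMED (7) puts `c`
outside every flat tube, so `rₖ(c) > ρₖ(c⁰) ≥ R₀ ≥ 100 Mₖ > r₊` (SEAMED (1), HonestCore (a)) and
`c ∈ domₖ`; ONE ATLAS (6) gives `Φ c = Ψₖ c`; clock lag (9) (or hole-earliness) gives `tₖ(c) ≤ τ₁`;
the RIDE concludes. Clauses: Hc(a), Sm1, Sm6, Sm7, Sm9, `tubeRide`. -/
theorem boardAtContact (𝓢 : Spacetime.{0} 4) (O : Set 𝓢.carrier) (d : FinalStateDecomposition 𝓢 O 2)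
    (R : Fin d.N → ℝ → ℝ) (R₀ : ℝ) (hc : Hc 𝓢 O 2 d R₀) (hs : Sm 𝓢 O d R R₀)
    (τ₁ : ℝ) (hτ₁ : d.τ₀ < τ₁) (c : d.flatDomain) (k : Fin d.N) (hc₀ : d.τ₀ < c.1 0)
    (hc₁ : c.1 0 ≤ τ₁) (hrR : (d.background k).radius c.1 ≤ R k ((d.background k).time c.1)) :
    d.flatChart c ∈ 𝓢.metric.causalPast 𝓢.timeOrientation (certifiedSlab d R τ₁) := by
  have hride := tubeRide 𝓢 O d R R₀ hc hs τ₁ hτ₁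
  obtain ⟨ha, -, -, -⟩ := hc
  obtain ⟨h1, -, -, -, -, h6, h7, -, h9, -, -, -⟩ := hs
  have hout : ∀ j, d.excision j (c.1 0) < (d.background j).radius c.1 := h7 c hc₀.le
  have hR₀r : R₀ < (d.background k).radius c.1 := lt_of_le_of_lt ((h1 k).2.2 (c.1 0)).2 (hout k)
  -- `c` lies in the chart domain of hole `k`
  have hM := d.mass_pos k
  have hdom : c.1 ∈ (d.background k).domain := by
    show poincareInv (d.motion k).1 (d.motion k).2 c.1 ∈ Kerr.exterior (d.mass k) (d.spin k)
    rw [Kerr.mem_exterior]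
    have h2M := rPlus_le_two_mul hM.le (d.spin k)
    have h100 := (ha k).2.1
    refine max_lt ?_ ?_
    · show Kerr.rPlus (d.mass k) (d.spin k) < (d.background k).radius c.1
      linarith
    · show (0 : ℝ) < (d.background k).radius c.1
      linarith
  -- one atlas
  obtain ⟨hc', hEq⟩ := h6 k c.1 hdom hc₀.le hout (by linarith)
  -- hole clock at most `τ₁`
  have htk : (d.background k).time c.1 ≤ τ₁ := by
    by_cases h : d.τ₀ ≤ (d.background k).time c.1
    · exact (h9 k c.1 h (by linarith)).trans hc₁
    · push Not at h
      linarith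
  have := hride k ⟨c.1, hdom⟩ (Or.inr hc₀.le) hR₀r.le hrR htk
  -- `⟨c.1, c.2⟩ = c` by structure eta; transport along the one-atlas identity
  show d.flatChart ⟨c.1, hc'⟩ ∈ 𝓢.metric.causalPast 𝓢.timeOrientation (certifiedSlab d R τ₁)
  rw [← hEq]
  exact this

/-- **`FirstContact → FlatBoarding`** (PROVED): no contact ⇒ the flat slab is part of the
certified slab; contact at `c` ⇒ `Φ y ≤ Φ c` and `boardAtContact`, then `J⁻ ∘ J⁻ = J⁻`. -/
theorem flatBoarding_of_firstContact (h : FirstContact) : FlatBoarding := by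
  intro 𝓢 O d R R₀ hc hs τ₁ hτ₁ y hy₀ hy₁
  have hn2 : (2 : WithTop ℕ∞) ≤ ((⊤ : ℕ∞) : WithTop ℕ∞) := WithTop.coe_le_coe.mpr le_top
  rcases h 𝓢 O d R R₀ hc hs τ₁ hτ₁ y hy₀ hy₁ with hslab | ⟨c, k, hc₀, hc₁, hrR, hyc⟩
  · refine LorentzianMetric.causalFuture_mono ?_ hslab
    intro z hz
    exact Or.inl hz
  · have hcS := boardAtContact 𝓢 O d R R₀ hc hs τ₁ hτ₁ c k hc₀ hc₁ hrR
    have h2 : d.flatChart y ∈ 𝓢.metric.causalFuture 𝓢.timeOrientation.reverse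
        (𝓢.metric.causalFuture 𝓢.timeOrientation.reverse (certifiedSlab d R τ₁)) :=
      LorentzianMetric.causalFuture_mono (Set.singleton_subset_iff.mpr hcS) hyc
    rw [LorentzianMetric.causalFuture_causalFuture_eq hn2] at h2
    exact h2

/-! ### REACH from BOARDING, PROVED (the routing of charted points; hole half = `holeAnchoring` +
`tubeRide` + collar/far-leaf conversion to flat points by SEAMED (9), (8), (12), (6), (10)) -/

/-- **`FlatBoarding → ChartedReach`.** A charted point `z ∉ certifiedLate d R τ₁` is either
flat-late `Φ y` (`y⁰ > τ₀`; `y⁰ > τ₁` would put it in `certifiedLate`, so `y⁰ ≤ τ₁` and BOARDING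
applies) or hole-late `Ψᵢ x` (`tᵢ > τ₀`), and then: `rᵢ ≤ Rᵢ(tᵢ)`: `tᵢ > τ₁` excluded (certified-late),
`tᵢ = τ₁` on the hole disc of the slab, `tᵢ < τ₁` by the RIDE (`R₀ ≤ rᵢ`) or ANCHORING (`rᵢ < R₀ <
Rᵢ(τ₁)`); collar `Rᵢ(tᵢ) < rᵢ ≤ Rᵢ(tᵢ) + 1`: clock lag (9) gives `x⁰ ≥ tᵢ > τ₀`, margin (8) and
disjointness (12) put `x` outside every flat tube, ONE ATLAS (6) makes `z = Φ x` flat-late; far leaf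
`rᵢ > Rᵢ(tᵢ) + 1`: (10) puts `z` in the radiation zone. Clauses: Hc(a),(b) (via the two lemmas),
Sm1, Sm5 (ride), Sm6, Sm8, Sm9, Sm10, Sm12. -/
theorem chartedReach_of_boarding (hboard : FlatBoarding) : ChartedReach := by
  intro 𝓢 O d R R₀ hc hs τ₁ hτ₁ z hz
  obtain ⟨hz, hzF⟩ := hz
  have hB := hboard 𝓢 O d R R₀ hc hs τ₁ hτ₁
  have hride := tubeRide 𝓢 O d R R₀ hc hs τ₁ hτ₁
  have hanch := holeAnchoring 𝓢 O d R R₀ hc hs τ₁ hτ₁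
  obtain ⟨h1, -, -, -, -, h6, -, h8, h9, h10, -, h12⟩ := hs
  -- a flat-late point outside the certified late region boards
  have flat : ∀ y : d.flatDomain, d.τ₀ < y.1 0 → d.flatChart y ∉ certifiedLate d R τ₁ →
      d.flatChart y ∈ 𝓢.metric.causalPast 𝓢.timeOrientation (certifiedSlab d R τ₁) := by
    intro y hy hyF
    rcases le_or_gt (y.1 0) τ₁ with hle | hlt
    · exact hB y hy hle
    · exact absurd (Or.inl ⟨y, hlt, rfl⟩) hyF
  rcases hz with hz | hz
  · -- radiation zone
    obtain ⟨y, hy, rfl⟩ := hz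
    exact flat y hy hzF
  · -- black-hole region of hole `i`
    obtain ⟨i, hz⟩ := mem_iUnion.mp hz
    obtain ⟨x, hxt, rfl⟩ := hz
    have hxt : d.τ₀ < (d.background i).time x.1 := hxt
    have hR4 : R₀ + 4 ≤ R i ((d.background i).time x.1) := ((h1 i).2.2 _).1
    have hmono : Monotone (R i) := (h1 i).1
    by_cases hin : (d.background i).radius x.1 ≤ R i ((d.background i).time x.1)
    · -- inside the closed certified tube
      rcases lt_trichotomy ((d.background i).time x.1) τ₁ with hlt | heq | hgt
      · by_cases hr₀ : R₀ ≤ (d.background i).radius x.1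
        · exact hride i x (Or.inl hxt.le) hr₀ hin hlt.le
        · push Not at hr₀
          refine hanch i x hxt hlt ?_
          have := ((h1 i).2.2 τ₁).1
          linarith
      · -- on the hole disc of the certified slab
        have hS : d.chart i x ∈ certifiedSlab d R τ₁ := by
          refine Or.inr (mem_iUnion.mpr ⟨i, x, ⟨heq, ?_⟩, rfl⟩)
          rw [← heq]
          exact hin
        exact LorentzianMetric.subset_causalPast _ _ _ hS
      · -- certified-late: excluded
        have hzF' : d.chart i x ∈ certifiedLate d R τ₁ := Or.inr (mem_iUnion.mpr ⟨i, x, ⟨hgt, hin⟩, rfl⟩)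
        exact absurd hzF' hzF
    · push Not at hin
      by_cases hcol : (d.background i).radius x.1 ≤ R i ((d.background i).time x.1) + 1
      · -- collar: the point is flat-late by ONE ATLAS
        have hlag : (d.background i).time x.1 ≤ x.1 0 := h9 i x.1 hxt.le (by linarith)
        have hx0 : d.τ₀ < x.1 0 := lt_of_lt_of_le hxt hlag
        have hout : ∀ k, d.excision k (x.1 0) < (d.background k).radius x.1 := by
          intro k
          by_contra hk
          push Not at hk
          have h8k : (d.background k).radius x.1 + 2 ≤ R k ((d.background k).time x.1) :=
            h8 k x.1 hx0.le hk
          rcases eq_or_ne k i with rfl | hki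
          · linarith
          · have h12k : R k ((d.background k).time x.1) + 1 < (d.background k).radius x.1 :=
              h12 i k x.1 (Ne.symm hki) (Or.inl hx0.le) hcol
            linarith
        obtain ⟨hy', hEq⟩ := h6 i x.1 x.2 hx0.le hout hcol
        have hxF : d.flatChart ⟨x.1, hy'⟩ ∉ certifiedLate d R τ₁ := by rw [← hEq]; exact hzF
        have := flat ⟨x.1, hy'⟩ hx0 hxF
        rw [← hEq] at this
        exact this
      · -- far leaf: the point is in the radiation zone
        push Not at hcol
        have hrz : d.chart i x ∈ d.radiationZone := h10 i ⟨x, ⟨hxt, hcol⟩, rfl⟩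
        obtain ⟨y, hy, hyEq⟩ := hrz
        have hyF : d.flatChart y ∉ certifiedLate d R τ₁ := by rw [hyEq]; exact hzF
        have := flat y hy hyF
        rw [hyEq] at this
        exact this

/-! ## §5 Composition: the stubs give C⁺, and C⁺ gives the crux (both PROVED) -/

/-- The two stubs imply the abstract statement C⁺: first-entry covering with `C = d.charted`,
`F = certifiedLate d R τ₁` (open, `isOpen_certifiedLate`), `S = certifiedSlab d R τ₁`; REACH
(`chartedReach_of_boarding ∘ flatBoarding_of_firstContact`, from FIRST CONTACT) discharges `C \ F`,
FRONTIER discharges `(closure F ∩ O) \ F`; clause (i) of `HasExhaustiveCharts` is SEAMED (2) verbatim. -/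
theorem abstract_of_stubs (hcontact : FirstContact) (hfront : FrontierBelowSlab) : AbstractExhaust := by
  intro 𝓢 O d R R₀ hE1 hE2 hc hs
  refine ⟨R, hs.2.1, fun τ₁ hτ₁ ↦ ?_⟩
  exact firstEntryCovering 𝓢 O d.charted (certifiedLate d R τ₁) (certifiedSlab d R τ₁)
    (isOpen_certifiedLate 𝓢 O d R R₀ hs τ₁ hτ₁) (certifiedLate_subset_charted d R hτ₁)
    d.charted_subset hE1 hE2
    (chartedReach_of_boarding (flatBoarding_of_firstContact hcontact) 𝓢 O d R R₀ hc hs τ₁ hτ₁)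
    (hfront 𝓢 O d R R₀ hc hs τ₁ hτ₁)

/-- **The skeleton concludes the crux BY NAME** (kernel-checked composition, no `sorry`):
`stub_firstContact → stub_frontier ⊢ Theses.StarvedNecks.SeamedChartsExhaust` (hypotheses spelled through
the name-keyed aliases `Registered.stub_*`, definitionally `FirstContact` / `FrontierBelowSlab`), through
`abstract_of_stubs` (C⁺) and the transfer `crux_of_abstract`. -/
theorem SeamedChartsExhaust_of (h_firstContact : Registered.stub_firstContact)
    (h_frontier : Registered.stub_frontier) :
    Summit.FinalStateConjecture.FinalStateConjecture.Theses.StarvedNecks.SeamedChartsExhaust :=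
  crux_of_abstract (abstract_of_stubs h_firstContact h_frontier)

/-! ## §6 Disproof used — kernel-checked certificate that HonestCore (d) enters at `stub_boarding`

`Negative/WithoutFutureOrientation.lean` (landed, p73931): the spacetime-level crux with HonestCore (d)
deleted is FALSE (time-reversed flat chart on Minkowski, `Negative/ReversedFlatChart.lean`). The same
model kills the BOARDING statement with (d) deleted (everything else verbatim), so the stub set places
the load-bearing hypothesis H = Hc(d) exactly in `stub_firstContact` (the RIDE uses SEAMED (5) instead;
`boardAtContact`, REACH and FRONTIER never touch (d)). No stub is an instance of the refuted statement:
both carry the full `Hc`. -/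

/-- `Hc` with clause (d) deleted. -/
def HcABC (𝓢 : Spacetime.{0} 4) (O : Set 𝓢.carrier) (k : ℕ) (d : FinalStateDecomposition 𝓢 O k)
    (R₀ : ℝ) : Prop :=
  let B := d.background; let t := fun i ↦ (B i).time; let r := fun i ↦ (B i).radius; let Ψ := d.chart;
  (∀ i, Kerr.IsSubextremal (d.mass i) (d.spin i) ∧ 100 * d.mass i ≤ R₀ ∧
      0 < ((d.motion i).1 : E4 ≃L[ℝ] E4) (E4.basisVector 0) 0) ∧
  (∀ i (ϱ τ₂ : ℝ), R₀ ≤ ϱ → d.τ₀ < τ₂ →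
      Ψ i '' {x | d.τ₀ < t i x.1 ∧ t i x.1 < τ₂ ∧ r i x.1 < ϱ} ⊆
        𝓢.metric.causalPast 𝓢.timeOrientation (Ψ i '' (B i).truncTimeSlab ϱ τ₂)) ∧
  (∀ i (τ' : ℝ) (ϱ : ℝ → ℝ), Continuous ϱ → d.τ₀ < τ' →
      let A := Ψ i '' {x | τ' ≤ t i x.1 ∧ r i x.1 ≤ ϱ (t i x.1)}; closure A ∩ O ⊆ A)

/-- BOARDING with HonestCore (d) deleted (and SEAMED kept verbatim). -/
def FlatBoardingWithoutOrientation : Prop :=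
  ∀ (𝓢 : Spacetime.{0} 4) (O : Set 𝓢.carrier) (d : FinalStateDecomposition 𝓢 O 2)
    (R : Fin d.N → ℝ → ℝ) (R₀ : ℝ), HcABC 𝓢 O 2 d R₀ → Sm 𝓢 O d R R₀ →
    ∀ τ₁ : ℝ, d.τ₀ < τ₁ → ∀ y : d.flatDomain, d.τ₀ < y.1 0 → y.1 0 ≤ τ₁ →
      d.flatChart y ∈ 𝓢.metric.causalPast 𝓢.timeOrientation (certifiedSlab d R τ₁)

section DisproofUsed

open Summit.FinalStateConjecture.FinalStateConjecture.Theorems.SeamedChartsExhaust.Negative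

/-- SEAMED holds for the reversed model (ten clauses vacuous at `N = 0`; (3) by the vanishing
deviation; (11) because the images of the closed flat-late slabs are the closed half-spaces
`{x⁰ ≤ −τ'}`). -/
theorem sm_reversedModel (R : Fin ReversedModel.decomp.N → ℝ → ℝ) :
    Sm Minkowski.spacetime ReversedModel.O ReversedModel.decomp R 0 := by
  refine ⟨fun i ↦ i.elim0, fun i ↦ i.elim0, ?_, fun i ↦ i.elim0, fun i ↦ i.elim0, fun i ↦ i.elim0,
    fun _ _ j ↦ j.elim0, fun j ↦ j.elim0, fun j ↦ j.elim0, fun j ↦ j.elim0, ?_, fun j ↦ j.elim0⟩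
  · show supCkENorm _ 0 (Minkowski.spacetime.deviationExtend (Minkowski.backgroundOn ⊤) ReversedModel.Φ) ≤ 10⁻¹
    rw [ReversedModel.deviationExtend_Φ, supCkENorm_zero]
    exact zero_le
  · intro τ' _ x hx
    have hc : IsClosed {x : E4 | x 0 ≤ -τ'} :=
      isClosed_le (PiLp.continuous_apply 2 _ 0) continuous_const
    have hx' : x ∈ closure (ReversedModel.Φ '' {y : (⊤ : Opens E4) | τ' ≤ y.1 0} : Set E4) := hx
    rw [ReversedModel.image_Φ_ge, hc.closure_eq] at hx'
    left
    have : x ∈ (ReversedModel.Φ '' {y : (⊤ : Opens E4) | τ' ≤ y.1 0} : Set E4) := by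
      rw [ReversedModel.image_Φ_ge]; exact hx'
    exact this

/-- **BOARDING needs HonestCore (d)**: with (d) deleted the boarding statement is FALSE — in the
reversed model (`τ₀ = 0`, `τ₁ = 1`) the flat-late point `Φ(1/2, 0) = (−1/2, 0)` is not in
`J⁻(certifiedSlab) = J⁻({x⁰ = −1}) = {x⁰ ≤ −1}`. Instance of the landed negative lemma's model
(`Negative/ReversedFlatChart.lean`); this is the `_false_without_(d)` obstruction the line honours AT
`stub_firstContact` (the flow half of BOARDING; `boardAtContact` is (d)-free). -/
theorem not_flatBoarding_without_orientation : ¬ FlatBoardingWithoutOrientation := by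
  intro h
  set y : E4 := (1 / 2 : ℝ) • E4.basisVector 0 with hy
  have hy0 : y 0 = 1 / 2 := by simp [hy]
  have hmem := h Minkowski.spacetime ReversedModel.O ReversedModel.decomp Fin.elim0 0
    ⟨fun i ↦ i.elim0, fun i ↦ i.elim0, fun i ↦ i.elim0⟩ (sm_reversedModel _) 1
    (show ReversedModel.decomp.τ₀ < 1 from one_pos) ⟨y, trivial⟩
    (show ReversedModel.decomp.τ₀ < y 0 by rw [ReversedModel.decomp_τ₀, hy0]; norm_num)
    (show y 0 ≤ 1 by rw [hy0]; norm_num)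
  obtain ⟨q, hq, hpq⟩ := ReversedModel.exists_mem_causalPast_singleton_of_mem_causalPast hmem
  -- `decomp.flatChart ⟨y, _⟩` is `T y` by `rfl`
  have hle : ReversedModel.T y 0 ≤ q 0 := ReversedModel.time_le_of_mem_causalPast_singleton hpq
  rw [ReversedModel.T_apply_zero, hy0] at hle
  rcases hq with hq | hq
  · have hq' : q ∈ (ReversedModel.Φ '' (Minkowski.backgroundOn ⊤).timeSlab 1 : Set E4) := hq
    rw [ReversedModel.image_Φ_timeSlab] at hq'
    have : q 0 = -1 := hq'
    linarith
  · obtain ⟨i, -⟩ := mem_iUnion.mp hq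
    exact i.elim0

end DisproofUsed

/-! ## §7 Regression harness I: the `N = 0` case of every stub statement, in EVERY spacetime

With no hole, RIDE is vacuous, BOARDING is the pure `e₀`-flow (HonestCore (d) + the structure field
`{x⁰ > τ₀} ⊆ U`), REACH follows from BOARDING, FRONTIER from SEAMED (11) (Triage3.frontierBelowSlab_N0).
These are unit tests of the SIGN/STRICTNESS conventions of `certifiedLate` (`τ₁ < y⁰`), `certifiedSlab`
(`y⁰ = τ₁`) and of the stub statements; they re-run unchanged against any repaired SEAMED-R. -/

section NZero

variable (𝓢 : Spacetime.{0} 4) (O : Set 𝓢.carrier) (d : FinalStateDecomposition 𝓢 O 2)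
  (R : Fin d.N → ℝ → ℝ) (R₀ : ℝ)

/-- RIDE at `N = 0`: vacuous. -/
theorem tubeRide_N0 (hN : d.N = 0) (τ₁ : ℝ) (j : Fin d.N) : False := (Fin.cast hN j).elim0

/-- FIRST CONTACT at `N = 0` in every spacetime (always the no-contact branch), from HonestCore (d)
alone: flow along the `e₀`-line from `y` (`τ₀ < y⁰ ≤ τ₁`) to the flat slab `{x⁰ = τ₁}`; the segment
stays in `U ⊇ {x⁰ > τ₀}` (structure field). -/
theorem firstContact_N0 (hN : d.N = 0)
    (hd : ∀ y : d.flatDomain, d.τ₀ < y.1 0 →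
      𝓢.timeOrientation.IsFutureDirected (mfderiv 𝓘(ℝ, E4) (𝓡 4) d.flatChart y (E4.basisVector 0)))
    (τ₁ : ℝ) (hτ₁ : d.τ₀ < τ₁) (y : d.flatDomain) (hy₀ : d.τ₀ < y.1 0) (hy₁ : y.1 0 ≤ τ₁) :
    d.flatChart y ∈ 𝓢.metric.causalPast 𝓢.timeOrientation
      (d.flatChart '' (Minkowski.backgroundOn d.flatDomain).timeSlab τ₁) := by
  haveI : IsEmpty (Fin d.N) := ⟨fun i ↦ (Fin.cast hN i).elim0⟩
  set s := τ₁ - y.1 0 with hs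
  have hs0 : 0 ≤ s := by linarith
  set ε := (y.1 0 - d.τ₀) / 2 with hεdef
  have hε : 0 < ε := by rw [hεdef]; linarith
  have hmem : ∀ σ ∈ Icc (-ε) (s + ε), y.1 + σ • E4.basisVector 0 ∈ d.flatDomain := by
    intro σ hσ
    apply d.setOf_lt_excision_subset_flatDomain
    refine ⟨?_, fun i ↦ (Fin.cast hN i).elim0⟩
    show d.τ₀ < (y.1 + σ • E4.basisVector 0) 0
    have h1 : -ε ≤ σ := hσ.1
    simp
    linarith
  have hflow := line_mem_causalFuture d.isLateChart_flat.contMDiff (E4.basisVector 0) y.1 y.2 hs0 hε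
    hmem (by
      rintro z ⟨σ, hσ, hzσ⟩
      apply hd
      show d.τ₀ < z.1 0
      rw [← hzσ]
      have h1 : 0 ≤ σ := hσ.1
      simp
      linarith)
  have hz : (⟨y.1 + s • E4.basisVector 0, hmem s ⟨by linarith, by linarith⟩⟩ : d.flatDomain) ∈
      (Minkowski.backgroundOn d.flatDomain).timeSlab τ₁ := by
    show (y.1 + s • E4.basisVector 0) 0 = τ₁
    simp [hs]
  have hzS : d.flatChart ⟨y.1 + s • E4.basisVector 0, hmem s ⟨by linarith, by linarith⟩⟩ ∈
      d.flatChart '' (Minkowski.backgroundOn d.flatDomain).timeSlab τ₁ :=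
    ⟨_, hz, rfl⟩
  -- `⟨y.1, y.2⟩ = y` by structure eta
  have hpy : d.flatChart y ∈ 𝓢.metric.causalPast 𝓢.timeOrientation
      {d.flatChart ⟨y.1 + s • E4.basisVector 0, hmem s ⟨by linarith, by linarith⟩⟩} :=
    LorentzianMetric.mem_causalPast_of_mem_causalFuture hflow
  exact LorentzianMetric.causalFuture_mono (Set.singleton_subset_iff.mpr hzS) hpy

/-- BOARDING at `N = 0` in every spacetime (from `firstContact_N0`: the flat slab is part of the
certified slab). -/
theorem flatBoarding_N0 (hN : d.N = 0)
    (hd : ∀ y : d.flatDomain, d.τ₀ < y.1 0 →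
      𝓢.timeOrientation.IsFutureDirected (mfderiv 𝓘(ℝ, E4) (𝓡 4) d.flatChart y (E4.basisVector 0)))
    (τ₁ : ℝ) (hτ₁ : d.τ₀ < τ₁) (y : d.flatDomain) (hy₀ : d.τ₀ < y.1 0) (hy₁ : y.1 0 ≤ τ₁) :
    d.flatChart y ∈ 𝓢.metric.causalPast 𝓢.timeOrientation (certifiedSlab d R τ₁) := by
  refine LorentzianMetric.causalFuture_mono ?_ (firstContact_N0 𝓢 O d hN hd τ₁ hτ₁ y hy₀ hy₁)
  intro z hz
  exact Or.inl hz

/-- REACH at `N = 0` in every spacetime: a charted point is flat-late `Φ y`, `y⁰ > τ₀`; if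
`y⁰ > τ₁` it is certified-late, else BOARDING (`flatBoarding_N0`). -/
theorem chartedReach_N0 (hN : d.N = 0)
    (hd : ∀ y : d.flatDomain, d.τ₀ < y.1 0 →
      𝓢.timeOrientation.IsFutureDirected (mfderiv 𝓘(ℝ, E4) (𝓡 4) d.flatChart y (E4.basisVector 0)))
    (τ₁ : ℝ) (hτ₁ : d.τ₀ < τ₁) :
    d.charted \ certifiedLate d R τ₁ ⊆ 𝓢.metric.causalPast 𝓢.timeOrientation (certifiedSlab d R τ₁) := by
  haveI : IsEmpty (Fin d.N) := ⟨fun i ↦ (Fin.cast hN i).elim0⟩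
  rintro z ⟨hz, hzF⟩
  rw [FinalStateDecomposition.charted, Set.iUnion_of_empty, Set.union_empty] at hz
  obtain ⟨y, hy, rfl⟩ := hz
  have hy' : d.τ₀ < y.1 0 := hy
  rcases le_or_gt (y.1 0) τ₁ with hle | hlt
  · exact flatBoarding_N0 𝓢 O d R hN hd τ₁ hτ₁ y hy' hle
  · exact absurd (Or.inl ⟨y, hlt, rfl⟩) hzF

/-- FRONTIER at `N = 0` in every spacetime, from SEAMED (11) and the slab convention alone
(Triage3.frontierBelowSlab_N0). -/
theorem frontierBelowSlab_N0 (hN : d.N = 0) (hs : Sm 𝓢 O d R R₀) (τ₁ : ℝ) (hτ₁ : d.τ₀ < τ₁) :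
    (closure (certifiedLate d R τ₁) ∩ O) \ certifiedLate d R τ₁ ⊆
      𝓢.metric.causalPast 𝓢.timeOrientation (certifiedSlab d R τ₁) := by
  haveI : IsEmpty (Fin d.N) := hN ▸ Fin.isEmpty'
  obtain ⟨-, -, -, -, -, -, -, -, -, -, hS11, -⟩ := hs
  rintro z ⟨⟨hzcl, -⟩, hzF⟩
  have hF : certifiedLate d R τ₁ = d.flatChart '' (Minkowski.backgroundOn d.flatDomain).lateRegion τ₁ := by
    rw [certifiedLate, Set.iUnion_of_empty, Set.union_empty]
  rw [hF] at hzcl hzF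
  have hsub : d.flatChart '' (Minkowski.backgroundOn d.flatDomain).lateRegion τ₁ ⊆
      d.flatChart '' {y | τ₁ ≤ y.1 0} := by
    rintro _ ⟨y, hy, rfl⟩
    exact ⟨y, le_of_lt (show τ₁ < y.1 0 from hy), rfl⟩
  have h11 := hS11 τ₁ hτ₁ (closure_mono hsub hzcl)
  rw [Set.iUnion_of_empty, Set.union_empty] at h11
  obtain ⟨y, hy, rfl⟩ := h11
  have hy' : y.1 0 = τ₁ := by
    rcases (show τ₁ ≤ y.1 0 from hy).eq_or_lt with h | h
    · exact h.symm
    · exact absurd ⟨y, h, rfl⟩ hzF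
  exact LorentzianMetric.subset_causalPast _ _ _ (Or.inl ⟨y, hy', rfl⟩)

/-- Hence C⁺ itself holds at `N = 0` in every spacetime (HonestCore (d) + SEAMED (11) only). -/
theorem abstractExhaust_N0 (hN : d.N = 0)
    (hE1 : O ⊆ 𝓢.metric.chronologicalPast 𝓢.timeOrientation d.charted)
    (hE2 : ∀ p ∈ O, ∀ q ∈ O, 𝓢.metric.causalFuture 𝓢.timeOrientation {p} ∩
        𝓢.metric.causalPast 𝓢.timeOrientation {q} ⊆ O)
    (hc : Hc 𝓢 O 2 d R₀) (hs : Sm 𝓢 O d R R₀) : HasExhaustiveCharts d := by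
  refine ⟨R, hs.2.1, fun τ₁ hτ₁ ↦ ?_⟩
  exact firstEntryCovering 𝓢 O d.charted (certifiedLate d R τ₁) (certifiedSlab d R τ₁)
    (isOpen_certifiedLate 𝓢 O d R R₀ hs τ₁ hτ₁) (certifiedLate_subset_charted d R hτ₁)
    d.charted_subset hE1 hE2 (chartedReach_N0 𝓢 O d R hN hc.2.2.2 τ₁ hτ₁)
    (frontierBelowSlab_N0 𝓢 O d R R₀ hN hs τ₁ hτ₁)

end NZero

/-! ## §8 Regression harness II: satisfiability — the honest `N = 0` Minkowski instance of C⁺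
(card `abstract-exterior`, cheapest falsifier, RUN: Ideate1.MinkowskiN0, re-run here against THIS file's
`Hc`/`Sm` and stub statements). `Minkowski.spacetime` (carrier `E4`, metric `η`, orientation `∂ₜ`),
`O = {0 ≤ x⁰}`, flat chart = inclusion of `⊤`, `τ₀ = 0`, no hole: (E1), (E2), `Hc`, `Sm` all HOLD
(so the hypotheses of every stub are jointly satisfiable in Lean), and so do the conclusion
`HasExhaustiveCharts d0` and the `d0`-instances of both stub statements. -/

namespace MinkowskiN0

open Minkowski

/-- View a point of `Minkowski.spacetime` as a point of `E4` (the carrier IS `E4`). -/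
abbrev toE4 (x : Minkowski.spacetime.carrier) : E4 := x

/-- The region `O = {x⁰ ≥ 0} = J⁺({x⁰ = 0}) ∩ I⁻({x⁰ > 0})` of Minkowski spacetime. -/
def O0 : Set Minkowski.spacetime.carrier := {x | 0 ≤ toE4 x 0}

/-- The flat background on all of `E4`. -/
abbrev B0 : ModelBackground := Minkowski.backgroundOn (⊤ : Opens E4)

/-- The flat chart: the inclusion of the whole of `E4`. -/
def Φ0 : B0.domain → Minkowski.spacetime.carrier := Subtype.val

theorem continuous_coord0 : Continuous fun x : E4 ↦ x 0 :=
  (continuous_apply 0).comp (PiLp.continuous_ofLp 2 _)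

theorem isOpen_lateRegion (τ : ℝ) : IsOpen (B0.lateRegion τ) :=
  isOpen_lt continuous_const (continuous_coord0.comp continuous_subtype_val)

theorem isLateChart_Φ0 : Minkowski.spacetime.IsLateChart B0 O0 0 Φ0 where
  contMDiff := contMDiff_subtype_val
  isOpenEmbedding :=
    (⊤ : Opens E4).isOpen.isOpenEmbedding_subtypeVal.comp (isOpen_lateRegion 0).isOpenEmbedding_subtypeVal
  image_subset := by
    rintro _ ⟨x, hx, rfl⟩
    exact le_of_lt (show (0 : ℝ) < x.1 0 from hx)

/-- The inclusion chart has zero deviation from `η`. -/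
theorem deviation_Φ0 (x : B0.domain) : Minkowski.spacetime.deviation B0 Φ0 x = 0 := by
  have h := Minkowski.chartMetric_background_val x
  show Minkowski.spacetime.chartMetric Minkowski.background
      (Subtype.val : Minkowski.background.domain → E4) x - Minkowski.bilin = 0
  rw [h]
  exact sub_self (Minkowski.bilin : E4 →L[ℝ] E4 →L[ℝ] ℝ)

theorem deviationExtend_Φ0 : Minkowski.spacetime.deviationExtend B0 Φ0 = 0 := by
  funext y
  have h := Minkowski.spacetime.deviationExtend_coe B0 Φ0 ⟨y, trivial⟩
  rw [deviation_Φ0] at h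
  exact h

/-- The `N = 0` decomposition of `O0`. -/
def d0 : FinalStateDecomposition Minkowski.spacetime O0 2 where
  N := 0
  mass := Fin.elim0
  spin := Fin.elim0
  mass_pos i := i.elim0
  abs_spin_le_mass i := i.elim0
  motion := Fin.elim0
  τ₀ := 0
  chart i := i.elim0
  isLateChart i := i.elim0
  tendsto_truncDeviationCk i := i.elim0
  exists_pairwise_disjoint _ := ⟨0, fun i ↦ i.elim0⟩
  excision := Fin.elim0
  tendsto_excision_div i := i.elim0
  flatDomain := ⊤
  setOf_lt_excision_subset_flatDomain _ _ := trivial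
  flatChart := Φ0
  isLateChart_flat := isLateChart_Φ0
  tendsto_deviationCk_flat := by
    have h : ∀ τ, Minkowski.spacetime.deviationCk B0 Φ0 2 τ = 0 := by
      intro τ
      unfold Spacetime.deviationCk
      rw [deviationExtend_Φ0]
      exact supCkENorm_zero _ _
    simp only [h]
    exact tendsto_const_nhds
  diff_subset_causalPast := by
    rw [Set.iUnion_of_empty, Set.empty_union, Set.iUnion_of_empty, Set.empty_union]
    rintro x ⟨hxO, hxnot⟩
    have hxO' : 0 ≤ toE4 x 0 := hxO
    have hx0 : toE4 x 0 = 0 :=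
      le_antisymm (not_lt.mp fun h ↦ hxnot ⟨⟨toE4 x, trivial⟩, h, rfl⟩) hxO'
    exact LorentzianMetric.subset_causalPast _ _ _ ⟨⟨toE4 x, trivial⟩, hx0, rfl⟩

theorem d0_N : d0.N = 0 := rfl
theorem d0_τ₀ : d0.τ₀ = 0 := rfl

theorem basisVector_zero_ne_zero : (E4.basisVector 0 : E4) ≠ 0 := by
  rw [ne_eq, ← norm_eq_zero]
  simp [E4.basisVector]

/-- Straight vertical lines `s ↦ x + s • e₀` are future TIMELIKE curves of Minkowski spacetime. -/
theorem isFutureTimelikeCurveOn_vertical (x : E4) (s : Set ℝ) :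
    Minkowski.spacetime.metric.IsFutureTimelikeCurveOn Minkowski.spacetime.timeOrientation
      (fun σ : ℝ ↦ x + σ • E4.basisVector 0) s := by
  intro σ _
  set v : E4 := E4.basisVector 0 with hv_def
  have hγ : HasDerivAt (fun σ : ℝ ↦ x + σ • v) v σ := by
    simpa using ((hasDerivAt_id σ).smul_const v).const_add x
  have hmd : MDifferentiableAt 𝓘(ℝ, ℝ) 𝓘(ℝ, E4) (fun σ : ℝ ↦ x + σ • v) σ :=
    mdifferentiableAt_iff_differentiableAt.mpr hγ.differentiableAt
  have hvel : velocity 𝓘(ℝ, E4) (fun σ : ℝ ↦ x + σ • v) σ = v := by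
    unfold velocity
    rw [mfderiv_eq_fderiv]
    change fderiv ℝ (fun σ : ℝ ↦ x + σ • v) σ 1 = v
    rw [hγ.hasFDerivAt.fderiv]
    simp
  refine ⟨hmd, ?_, ⟨?_, ?_⟩, ?_⟩
  · change Minkowski.bilin (velocity 𝓘(ℝ, E4) (fun σ : ℝ ↦ x + σ • v) σ)
      (velocity 𝓘(ℝ, E4) (fun σ : ℝ ↦ x + σ • v) σ) < 0
    rw [hvel, hv_def, Minkowski.bilin_basisVector_zero]
    norm_num
  · change Minkowski.bilin (velocity 𝓘(ℝ, E4) (fun σ : ℝ ↦ x + σ • v) σ)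
      (velocity 𝓘(ℝ, E4) (fun σ : ℝ ↦ x + σ • v) σ) ≤ 0
    rw [hvel, hv_def, Minkowski.bilin_basisVector_zero]
    norm_num
  · change velocity 𝓘(ℝ, E4) (fun σ : ℝ ↦ x + σ • v) σ ≠ 0
    rw [hvel, hv_def]
    exact basisVector_zero_ne_zero
  · change Minkowski.bilin (E4.basisVector 0) (velocity 𝓘(ℝ, E4) (fun σ : ℝ ↦ x + σ • v) σ) < 0
    rw [hvel, hv_def, Minkowski.bilin_basisVector_zero]
    norm_num

/-- (E1): `O0 ⊆ I⁻(d0.charted)` — every point is chronologically below `x + e₀`, which is in the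
radiation zone. -/
theorem e1 : O0 ⊆ Minkowski.spacetime.metric.chronologicalPast Minkowski.spacetime.timeOrientation
    d0.charted := by
  intro x hx
  have hx' : 0 ≤ toE4 x 0 := hx
  set p : E4 := toE4 x + (1 : ℝ) • E4.basisVector 0 with hp
  have hp0 : p 0 = toE4 x 0 + 1 := by simp [hp]
  have hpc : (p : Minkowski.spacetime.carrier) ∈ d0.charted := by
    refine Or.inl ⟨⟨p, trivial⟩, ?_, rfl⟩
    show (0 : ℝ) < p 0
    rw [hp0]
    linarith
  have hxp : (p : Minkowski.spacetime.carrier) ∈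
      Minkowski.spacetime.metric.chronologicalFuture Minkowski.spacetime.timeOrientation {x} :=
    ⟨x, rfl, fun σ : ℝ ↦ toE4 x + σ • E4.basisVector 0, 0, 1, zero_lt_one,
      isFutureTimelikeCurveOn_vertical (toE4 x) _, by simp, by simp [hp]⟩
  have h1 : x ∈ Minkowski.spacetime.metric.chronologicalPast Minkowski.spacetime.timeOrientation
      {(p : Minkowski.spacetime.carrier)} :=
    LorentzianMetric.mem_chronologicalPast_of_mem_chronologicalFuture hxp
  exact LorentzianMetric.chronologicalFuture_mono (g := Minkowski.spacetime.metric)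
    (τ := Minkowski.spacetime.timeOrientation.reverse) (singleton_subset_iff.mpr hpc) h1

/-- (E2): diamond convexity of `O0` — time is monotone along causal curves. -/
theorem e2 : ∀ p ∈ O0, ∀ q ∈ O0,
    Minkowski.spacetime.metric.causalFuture Minkowski.spacetime.timeOrientation {p} ∩
      Minkowski.spacetime.metric.causalPast Minkowski.spacetime.timeOrientation {q} ⊆ O0 := by
  intro p hp q _ x ⟨hxp, _⟩
  have hp' : 0 ≤ toE4 p 0 := hp
  have h : toE4 x ∈ {y : E4 | ‖E4.spatial y - E4.spatial (toE4 p)‖ ≤ y 0 - toE4 p 0} := by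
    rw [← Minkowski.causalFuture_singleton (toE4 p)]
    exact hxp
  have h' : ‖E4.spatial (toE4 x) - E4.spatial (toE4 p)‖ ≤ toE4 x 0 - toE4 p 0 := h
  show (0 : ℝ) ≤ toE4 x 0
  linarith [norm_nonneg (E4.spatial (toE4 x) - E4.spatial (toE4 p))]

/-- `Hc` holds for `d0` (any `R₀`): (a)–(c) vacuous, (d) `e₀` is future-directed for `η`. -/
theorem hc0 (R₀ : ℝ) : Hc Minkowski.spacetime O0 2 d0 R₀ := by
  refine ⟨fun i ↦ i.elim0, fun i ↦ i.elim0, fun i ↦ i.elim0, fun y _ ↦ ?_⟩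
  have h := mfderiv_subtypeVal (I' := 𝓡 4) (W := (⊤ : Opens E4)) y
  show Minkowski.spacetime.timeOrientation.IsFutureDirected
    (mfderiv 𝓘(ℝ, E4) (𝓡 4) (Subtype.val : (⊤ : Opens E4) → E4) y (E4.basisVector 0))
  erw [h]
  refine ⟨⟨?_, ?_⟩, ?_⟩
  · change Minkowski.bilin (E4.basisVector 0) (E4.basisVector 0) ≤ 0
    rw [Minkowski.bilin_basisVector_zero]; norm_num
  · change (E4.basisVector 0 : E4) ≠ 0
    exact basisVector_zero_ne_zero
  · change Minkowski.bilin (E4.basisVector 0) (E4.basisVector 0) < 0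
    rw [Minkowski.bilin_basisVector_zero]; norm_num

set_option maxHeartbeats 800000 in
/-- `Sm` holds for `d0` (with the empty radius family and any `R₀`): ten clauses vacuous, (3) the
zero deviation, (11) `{τ' ≤ x⁰}` closed. -/
theorem sm0 (R₀ : ℝ) : Sm Minkowski.spacetime O0 d0 Fin.elim0 R₀ := by
  unfold Sm
  refine ⟨?_, ?_, ?_, ?_, ?_, ?_, ?_, ?_, ?_, ?_, ?_, ?_⟩
  · intro i; exact i.elim0
  · intro i; exact i.elim0
  · show supCkENorm _ 0 (Minkowski.spacetime.deviationExtend B0 Φ0) ≤ 10⁻¹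
    rw [deviationExtend_Φ0, supCkENorm_zero]
    exact bot_le
  · intro i; exact i.elim0
  · intro i; exact i.elim0
  · intro i; exact i.elim0
  · intro _ _ j; exact j.elim0
  · intro j; exact j.elim0
  · intro j; exact j.elim0
  · intro j; exact j.elim0
  · intro τ' _
    have himg : Φ0 '' {y : B0.domain | τ' ≤ y.1 0} = {x : E4 | τ' ≤ x 0} := by
      ext x
      constructor
      · rintro ⟨y, hy, rfl⟩; exact hy
      · intro hx; exact ⟨⟨x, trivial⟩, hx, rfl⟩
    have hcl' : IsClosed ({x : E4 | τ' ≤ x 0}) := isClosed_le continuous_const continuous_coord0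
    have hcl : IsClosed (Φ0 '' {y : B0.domain | τ' ≤ y.1 0}) := himg ▸ hcl'
    exact (closure_minimal (subset_refl _) hcl).trans subset_union_left
  · intro j; exact j.elim0

/-- **The `N = 0` Minkowski regression test.** (E1), (E2), `Hc`, `Sm` hold for the honest trivial
configuration (JOINT SATISFIABILITY of every stub's hypotheses, in Lean); the conclusion
`HasExhaustiveCharts d0` holds (by the `N = 0` case of C⁺, `abstractExhaust_N0`); and the
`d0`-instances of the two stub statements hold (`firstContact_N0`, `frontierBelowSlab_N0`) —
checks of the sign/strictness conventions of `certifiedLate`/`certifiedSlab`/SEAMED (11). -/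
theorem regressionTest :
    (O0 ⊆ Minkowski.spacetime.metric.chronologicalPast Minkowski.spacetime.timeOrientation d0.charted) ∧
    (∀ p ∈ O0, ∀ q ∈ O0,
      Minkowski.spacetime.metric.causalFuture Minkowski.spacetime.timeOrientation {p} ∩
        Minkowski.spacetime.metric.causalPast Minkowski.spacetime.timeOrientation {q} ⊆ O0) ∧
    Hc Minkowski.spacetime O0 2 d0 17 ∧ Sm Minkowski.spacetime O0 d0 Fin.elim0 17 ∧
    HasExhaustiveCharts d0 ∧
    (∀ τ₁ : ℝ, d0.τ₀ < τ₁ → ∀ y : d0.flatDomain, d0.τ₀ < y.1 0 → y.1 0 ≤ τ₁ →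
      d0.flatChart y ∈ Minkowski.spacetime.metric.causalPast Minkowski.spacetime.timeOrientation
        (d0.flatChart '' (Minkowski.backgroundOn d0.flatDomain).timeSlab τ₁)) ∧
    (∀ τ₁ : ℝ, d0.τ₀ < τ₁ →
      (closure (certifiedLate d0 Fin.elim0 τ₁) ∩ O0) \ certifiedLate d0 Fin.elim0 τ₁ ⊆
        Minkowski.spacetime.metric.causalPast Minkowski.spacetime.timeOrientation
          (certifiedSlab d0 Fin.elim0 τ₁)) :=
  ⟨e1, e2, hc0 17, sm0 17,
    abstractExhaust_N0 Minkowski.spacetime O0 d0 Fin.elim0 17 d0_N e1 e2 (hc0 17) (sm0 17),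
    fun τ₁ hτ₁ y hy₀ hy₁ ↦ firstContact_N0 Minkowski.spacetime O0 d0 d0_N (hc0 17).2.2.2 τ₁ hτ₁ y hy₀ hy₁,
    fun τ₁ hτ₁ ↦ frontierBelowSlab_N0 Minkowski.spacetime O0 d0 Fin.elim0 17 d0_N (sm0 17) τ₁ hτ₁⟩

end MinkowskiN0

end Summit.FinalStateConjecture.FinalStateConjecture.Cruxes.SeamedChartsExhaust.AbstractExterior

end
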